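import Mathlib.Analysis.Distribution.SchwartzSpace.Deriv
import Mathlib.Analysis.InnerProductSpace.l2Space
import Mathlib.Analysis.SpecialFunctions.Pow.Deriv
import Mathlib.Analysis.SpecialFunctions.Sqrt
import Mathlib.Analysis.Complex.RealDeriv
import Mathlib.Analysis.Calculus.ContDiff.Deriv
import Mathlib.MeasureTheory.Integral.IntegralEqImproper
import Mathlib.MeasureTheory.Function.JacobianOneDim
import Mathlib.MeasureTheory.Integral.IntervalIntegral.FundThmCalculus
import Mathlib.Analysis.SpecialFunctions.Integrals.Basic
import Mathlib.Analysis.SpecialFunctions.Trigonometric.Inverse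
import Literature.NumberTheory.ConnesConsani2021.ProlateProjections
import Literature.NumberTheory.ConnesConsani2024.ProlateWaveCyclicPairs
import Literature.Analysis.UnboundedOperators.SymmetricPMap
import HarnessLib

/-!
# Connes–Moscovici 2022: the self-adjoint prolate wave operator and the UV behaviour of its spectrum — STATEMENTS AS PRINTED

LINE 1 — FRAMING. RH-FREE corpus literature (spectral theory of the prolate wave operator
`W_λ = −∂(λ² − x²)∂ + (2πλx)²` on `L²(ℝ)`).  The paper's slogan "the UV prolate spectrum matches
the zeros of zeta" is an ASYMPTOTIC COUNTING statement about eigenvalues of a differential operator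
(typed below as printed, `CM22_thm_5_1`, `CM22_prop_3_2`); it is NOT a statement about individual
zeros of `ζ` and nothing here mentions `RiemannHypothesis`.  bears_on: LADDER-RH W-C/W-P (sequel of
the Connes–Consani corpus, no leaf role).  WHAT THIS IS NOT: any claim about RH; nothing in this
file bears on the truth of RH.

Source: A. Connes, H. Moscovici, *The UV prolate spectrum matches the zeros of zeta*, Proc. Natl.
Acad. Sci. USA 119 (2022) e2123174119 [bib: `ConnesMoscovici2022`] = arXiv:2112.05500v1 (*Prolate
spheroidal operator and Zeta*; held text `paper:arxiv-2112.05500`, 13 chunks, formulas intact; the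
PNAS text `paper:doi-10-1073-pnas-2123174119` drops displays).  NUMBERING (cell file
`cc/LOCATORS-lit-1.md`): PNAS `k.m` = arXiv `(k+1).m` (PNAS leaves the introduction unnumbered);
every cite tag gives the PNAS number and the arXiv number with its chunk locator `pNNNN:Lnn`.

## What is typed, and how (tree vocabulary; nothing re-declared)

* The differential expression `W_λ` on functions IS the tree's
  `ConnesConsani2024.prolateWaveOpFun lam` (CCM 2024 eq. (5); also `ConnesConsani2021.prolateOp`
  for real-valued functions) — cited, not restated; here it is lifted to a continuous linear map on
  Mathlib's Schwartz space `𝓢(ℝ, ℂ)` (`prolateSchwartz`, via `SchwartzMap.derivCLM` /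
  `smulLeftCLM`; `prolateSchwartz_apply` checks the two agree) and to a partially defined operator
  on `L²(ℝ)` with core `𝓢(ℝ)` (`prolateCore`, arXiv §2 ¶1 "we regard `W` as an unbounded operator
  on `L²(ℝ)` with core the Schwartz space"), its closure `prolateMin = W_min` (Mathlib
  `LinearPMap.closure`) and `prolateMax = W_max := W_min^*` (Mathlib `LinearPMap.adjoint` of the
  core; the core is dense, `dense_schwartzL2`, so the adjoint is the honest one).
* The symplectic pairing `Ω` on `dom W_max` (`omegaForm`, arXiv (2.4)), the Wronskian `[ξ, η]`
  (`wronskian`, (2.6)), commutation of a partially defined operator with a map (`CommutesWith`),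
  the `L²` Fourier transform (`fourierL2` = Mathlib's `𝓕` on `Lp ℂ 2`, kernel `e^{−2πixy}` as in
  (2.3)), the cutoff projections `P_λ`, `P̂_λ` = the tree's `ConnesConsani2021.cutoffProj`,
  `cutoffProjHat`, Sonin's space = `ConnesConsani2021.soninSpace 1 1`, even `L²` functions =
  `ConnesConsani2021.evenPart`.
* `W_sa` (the paper's Definition before Thm 2.6 = PNAS Thm 1.6): "the restriction of `W_max` to
  `𝓛_β`"; "Explicitly, its domain consists of the elements `ξ ∈ dom(W_max)` satisfying the boundary
  conditions" (2.19)–(2.21).  Typed through these EXPLICIT boundary conditions on an a.e.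
  representative (`ProlateBC`, `prolateSASet`) as the predicate `IsProlateSA lam W` ("`W` is the
  restriction of `W_max` to that domain"); every statement about `W_sa` is then `∀ W, IsProlateSA
  lam W → …`, and the first clause of `CM22_thm_1_6` records that such a `W` exists (the printed
  Definition's well-definedness: the boundary conditions cut out a linear subspace).  No
  `SpectralTriple` structure, no instance, no notation.
* Unbounded-operator vocabulary = the tree's `Literature/Analysis/UnboundedOperators/SymmetricPMap.lean`
  (`LinearPMap.eigenspace`, `HasEigenvector`) + Mathlib (`IsSelfAdjoint` for `LinearPMap`,
  `HilbertBasis`).  "Discrete spectrum unbounded on both sides" = an orthonormal eigenbasis with real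
  eigenvalues `|μ_n| → ∞`, unbounded above and below (`HasDiscreteSpectrumUnboundedBothSides`).
* §4 (PNAS §3) semiclassics: the classical Hamiltonian `H_λ` (`cmHamiltonian`, arXiv (4.1)), the
  region `Ω_λ(E)` (`cmRegion`), `σ(E, λ) :=` its area (`cmSigma`; "the semiclassical approximation
  corresponds, for the restriction to even functions, to twice the area of `Ω_λ(E)`"), the
  integrals `I(a)`, `I_λ(a)` (`cmAreaIntegral`, `cmAreaIntegralLam`), the complete elliptic
  integrals `E(m)`, `K(m)` AS PRINTED (`ellipticE`, `ellipticK`; Mathlib has none).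
* §5 (PNAS §4) Darboux/Dirac: `p = x² − λ²`, `V`, `L = ∂(p∂) + V`, `∇ = p^{1/2}∂`, `U = p^{1/4}·`
  (`pOut`, `vPot`, `opL`, `opNabla`, `opU`, `opUinv`), the Riccati equation (5.1) (`IsRiccatiSol`),
  the Dirac operator (5.6) on pairs of functions (`opDirac`) — all at the level of functions on
  `(λ, ∞)`; the printed statements 4.1–4.3 are identities of differential expressions and are typed
  as such.

## Proved here (RH-FREE)
`prolateSchwartz_apply` (dictionary with `prolateWaveOpFun`), `prolateCore_apply`,
`dense_schwartzL2`, `CM22_lemma_1_4_ii` (`𝓕 1_{[−λ,λ]}(y) = sin(2πλy)/(πy)`, PNAS Lemma 1.4 (ii)),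
`two_mul_cmSigmaMain_half_sqrt_two` (the closing arithmetic of the proof of Thm 5.1:
`2σ_main(E/2, √2) = (E/2π)(log(E/2π) − 1) + 4`), and the DISCHARGES `CM22_lemma_4_1_holds`
(Darboux factorisation `L = U*(∇ + w)(∇ − w)U`) and `CM22_prop_4_3_holds` (`U*𝐃̸²U = diag(L, L + 2∇w)`)
— the printed "straightforward" computation, done pointwise (`q q′ = x`, `q² = p` for `q = √p`,
and the Riccati equation) — and `CM22_eq_3_3_holds` (area of `Ω_λ(E)` = `I_λ(a)` by Cavalieri over
the `q`-sections `[λ, √(λ² + a/(q² − λ²))]`, and the scaling (3.3) by the substitution `x = λy`;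
unconditional forms `cmSigma_eq_cmAreaIntegralLam`, `cmAreaIntegralLam_eq_mul_cmAreaIntegral`),
and `CM22_lemma_3_1_holds` (Lemma 3.1, `I(a) = aK(1−a) − E(1−a) + 1`: the substitution `y = 1/sin θ`
turns `I(a)` into `∫₀^{π/2} a/(√S + cos θ) dθ`, `S = 1 − (1−a)sin²θ`, and the printed boundary function
`g` becomes `a sin θ cos θ/(√S + cos θ)`, vanishing at both ends, with derivative
`a/√S − √S + cos θ − a/(√S + cos θ)`).

## Named facts (RH-FREE, unproved here, statements as printed)
`CM22_lemma_1_1` (deficiency indices `(4,4)`), `CM22_lemma_1_2` (boundary functional), `CM22_lemma_1_3`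
(`W` commutes with `P_λ`, `P̂_λ` on `dom W_min`), `CM22_lemma_1_4_i` (weak form), `CM22_lemma_1_5`
(basis of `dom W_max / dom W_min`), `CM22_thm_1_6` (self-adjointness, commutation, uniqueness,
discrete spectrum), `CM22_cor_1_7` (eigenfunction regularity/asymptotics), `CM22_cor_2_2` (negative
even eigenvectors lie in Sonin's space), `CM22_prop_3_2` (`σ(E,λ)` asymptotic), `CM22_lemma_4_2` (Riccati
solutions), `CM22_thm_5_1` (UV counting law at `λ = √2`, REDUCED FORM — see its docstring).
(`CM22_eq_3_3`, `CM22_lemma_3_1`, `CM22_lemma_4_1`, `CM22_prop_4_3` are named facts too, but DISCHARGED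
in this file.)

## Deliberately NOT typed (GAP rows for the cell's DAG)
* PNAS Lemma 2.1 (= arXiv Lemma 3.1): Borel summability of the asymptotic expansion at `∞` of the
  solution `ξ_μ` and its identification with `𝓕 φ_μ` — needs the power-series solution `f_μ` at the
  regular singular point and Borel summation, neither in the tree; its consequence Cor 2.2 IS typed.
* §4.1–4.2 numerical tables / figures, §7 (PNAS §6) "Final remarks" (speculative: 2D black hole
  metric, positive eigenvalues vs trivial zeros `χ(n) = (2n + 1/2)² + O(1)` quoted from [ORX],
  spectral truncation) — prose, no numbered statement.
* The Hilbert-space domain of the Dirac operator `𝐃̸` of Prop 4.3 / Thm 5.1 is not specified in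
  print; Thm 5.1 is therefore typed in the reduced form its printed proof actually establishes.

Nothing in this file bears on the truth of RH.
-/

noncomputable section

open Complex Set MeasureTheory Filter SchwartzMap
open scoped Real Topology FourierTransform ENNReal InnerProductSpace

namespace Literature.NumberTheory.ConnesMoscovici2022

open Literature.NumberTheory.ConnesConsani2021 Literature.NumberTheory.ConnesConsani2024

/-! ## The Hilbert space and the coefficients -/

/-- RH-FREE object. `L²(ℝ)` (complex-valued, Lebesgue measure), the Hilbert space of the paper.
[cite: ConnesMoscovici2022, §1 ¶1 (= arXiv §2 ¶1, chunk p0004:L13)] -/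
abbrev L2R : Type := Lp ℂ 2 (volume : Measure ℝ)

/-- RH-FREE object. `p(x) = λ² − x²` (complex-valued). [cite: ConnesMoscovici2022, §1 eq. (1.1) (= arXiv (2.1), chunk p0004:L5–L9)] -/
def pCoeff (lam : ℝ) (x : ℝ) : ℂ := ((lam ^ 2 - x ^ 2 : ℝ) : ℂ)

/-- RH-FREE object. `q(x) = (2πλ)² x²` (complex-valued). [cite: ConnesMoscovici2022, §1 eq. (1.1) (= arXiv (2.1), chunk p0004:L5–L9)] -/
def qCoeff (lam : ℝ) (x : ℝ) : ℂ := (((2 * π * lam) ^ 2 * x ^ 2 : ℝ) : ℂ)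

/-- RH-FREE. `p` has temperate growth (a polynomial), so multiplication by `p` acts on `𝓢(ℝ)`.
[cite: ConnesMoscovici2022, §1 ¶1 (= arXiv §2 ¶1, chunk p0004:L13–L15)] -/
theorem pCoeff_hasTemperateGrowth (lam : ℝ) : (pCoeff lam).HasTemperateGrowth := by
  unfold pCoeff; fun_prop

/-- RH-FREE. `q` has temperate growth. [cite: ConnesMoscovici2022, §1 ¶1 (= arXiv §2 ¶1, chunk p0004:L13–L15)] -/
theorem qCoeff_hasTemperateGrowth (lam : ℝ) : (qCoeff lam).HasTemperateGrowth := by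
  unfold qCoeff; fun_prop

/-! ## `W` on the Schwartz core, `W_min`, `W_max` -/

/-- RH-FREE object. **The prolate wave operator on Schwartz space**,
`W f = −(p f′)′ + q f = −∂ₓ((λ² − x²)∂ₓ f) + (2πλ)² x² f`, as a continuous linear map
`𝓢(ℝ, ℂ) → 𝓢(ℝ, ℂ)` (Mathlib `derivCLM`, `smulLeftCLM`): "we regard `W` as an unbounded operator on
`L²(ℝ)` with core the Schwartz space `𝒮(ℝ)`".  The differential expression is the tree's
`ConnesConsani2024.prolateWaveOpFun` (`prolateSchwartz_apply`).
[cite: ConnesMoscovici2022, §1 eq. (1.1) and ¶1 (= arXiv (2.1), chunk p0004:L5–L15); Intro eq. (prol1) chunk p0003:L14] -/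
def prolateSchwartz (lam : ℝ) : 𝓢(ℝ, ℂ) →L[ℂ] 𝓢(ℝ, ℂ) :=
  -((derivCLM ℂ ℂ).comp ((smulLeftCLM ℂ (pCoeff lam)).comp (derivCLM ℂ ℂ))) +
    smulLeftCLM ℂ (qCoeff lam)

/-- RH-FREE (PROVED dictionary). On a Schwartz function `prolateSchwartz` IS the tree's prolate wave
operator `prolateWaveOpFun lam` of CCM 2024 eq. (5) (same expression `−∂((λ²−x²)∂) + (2πλx)²`).
[cite: ConnesMoscovici2022, §1 eq. (1.1) (= arXiv (2.1), chunk p0004:L5–L9)] -/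
theorem prolateSchwartz_apply (lam : ℝ) (f : 𝓢(ℝ, ℂ)) (x : ℝ) :
    prolateSchwartz lam f x = prolateWaveOpFun lam f x := by
  have hp := pCoeff_hasTemperateGrowth lam
  have hq := qCoeff_hasTemperateGrowth lam
  have h1 : ((smulLeftCLM ℂ (pCoeff lam)) ((derivCLM ℂ ℂ) f) : ℝ → ℂ) =
      fun y ↦ ((lam ^ 2 - y ^ 2 : ℝ) : ℂ) * deriv f y := by
    funext y
    rw [smulLeftCLM_apply_apply hp, derivCLM_apply, smul_eq_mul, pCoeff]
  change -(derivCLM ℂ ℂ (smulLeftCLM ℂ (pCoeff lam) (derivCLM ℂ ℂ f)) x) +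
      (smulLeftCLM ℂ (qCoeff lam) f) x = _
  rw [derivCLM_apply, h1, smulLeftCLM_apply_apply hq, smul_eq_mul, qCoeff, prolateWaveOpFun]
  push_cast
  ring


/-- RH-FREE object. The Schwartz space inside `L²(ℝ)`: Mathlib's `SchwartzMap.toLpCLM` as a linear
map. [cite: ConnesMoscovici2022, §1 ¶1 (= arXiv §2 ¶1, chunk p0004:L13)] -/
def schwartzToL2 : 𝓢(ℝ, ℂ) →ₗ[ℂ] L2R :=
  ((toLpCLM ℂ ℂ 2 (volume : Measure ℝ) : 𝓢(ℝ, ℂ) →L[ℂ] L2R) : 𝓢(ℝ, ℂ) →ₗ[ℂ] L2R)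

/-- RH-FREE. Unfolding. [folklore] -/
private theorem schwartzToL2_apply (f : 𝓢(ℝ, ℂ)) : schwartzToL2 f = f.toLp 2 volume := rfl

/-- RH-FREE. `𝒮(ℝ) → L²(ℝ)` is injective (continuous a.e.-equal functions are equal).
[cite: ConnesMoscovici2022, §1 ¶1 (= arXiv §2 ¶1, chunk p0004:L13)] -/
theorem schwartzToL2_injective : Function.Injective schwartzToL2 :=
  fun f g h ↦ injective_toLp (F := ℂ) 2 (volume : Measure ℝ) (by simpa [schwartzToL2_apply] using h)

/-- RH-FREE object. The core `𝒮(ℝ) ⊂ L²(ℝ)` as a submodule. [cite: ConnesMoscovici2022, §1 ¶1 (= arXiv §2 ¶1, chunk p0004:L13)] -/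
abbrev schwartzL2 : Submodule ℂ L2R := LinearMap.range schwartzToL2

/-- RH-FREE. The core is dense in `L²(ℝ)` (Mathlib `SchwartzMap.denseRange_toLpCLM`), so the
adjoint `prolateMax` below is Mathlib's honest adjoint. [cite: ConnesMoscovici2022, §1 ¶1 (= arXiv §2 ¶1, chunk p0004:L13)] -/
theorem dense_schwartzL2 : Dense (schwartzL2 : Set L2R) := by
  have h := denseRange_toLpCLM (E := ℝ) (F := ℂ) (μ := (volume : Measure ℝ)) (p := 2)
    ENNReal.ofNat_ne_top
  refine Dense.mono ?_ h
  rintro _ ⟨f, rfl⟩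
  exact ⟨f, by rw [toLpCLM_apply, schwartzToL2_apply]⟩

/-- RH-FREE object. **`W` on its core** `𝒮(ℝ) ⊂ L²(ℝ)` as a partially defined operator
(`LinearPMap`): domain `schwartzL2`, `[f] ↦ [W f]`. [cite: ConnesMoscovici2022, §1 ¶1 (= arXiv §2 ¶1, chunk p0004:L13)] -/
def prolateCore (lam : ℝ) : L2R →ₗ.[ℂ] L2R where
  domain := schwartzL2
  toFun := schwartzL2.subtype ∘ₗ schwartzToL2.rangeRestrict ∘ₗ
    (prolateSchwartz lam : 𝓢(ℝ, ℂ) →L[ℂ] 𝓢(ℝ, ℂ)).toLinearMap ∘ₗ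
      (LinearEquiv.ofInjective schwartzToL2 schwartzToL2_injective).symm.toLinearMap

/-- RH-FREE. `prolateCore` acts on the class of a Schwartz function `f` as the class of `W f`.
[cite: ConnesMoscovici2022, §1 ¶1 (= arXiv §2 ¶1, chunk p0004:L13)] -/
theorem prolateCore_apply (lam : ℝ) (f : 𝓢(ℝ, ℂ)) :
    prolateCore lam ⟨schwartzToL2 f, LinearMap.mem_range_self _ f⟩ =
      schwartzToL2 (prolateSchwartz lam f) := by
  have h : (LinearEquiv.ofInjective schwartzToL2 schwartzToL2_injective).symm
      ⟨schwartzToL2 f, LinearMap.mem_range_self _ f⟩ = f := by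
    apply (LinearEquiv.ofInjective schwartzToL2 schwartzToL2_injective).injective
    rw [LinearEquiv.apply_symm_apply]
    ext
    rfl
  change schwartzL2.subtype (schwartzToL2.rangeRestrict (prolateSchwartz lam
    ((LinearEquiv.ofInjective schwartzToL2 schwartzToL2_injective).symm
      ⟨schwartzToL2 f, LinearMap.mem_range_self _ f⟩))) = _
  rw [h]
  rfl

/-- RH-FREE object. **`W_min`**: "its closure in the graph norm `W_min`" (Mathlib
`LinearPMap.closure` of the core; junk = the core itself if it were not closable — it is, being
symmetric). [cite: ConnesMoscovici2022, §1 ¶1 (= arXiv §2 ¶1, chunk p0004:L15–L16)] -/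
def prolateMin (lam : ℝ) : L2R →ₗ.[ℂ] L2R := (prolateCore lam).closure

/-- RH-FREE object. **`W_max = W_min^*`**: the adjoint of the core (Mathlib `LinearPMap.adjoint`;
the adjoint of an operator and of its closure coincide), "having domain
`dom(W_max) = {ξ ∈ L²(ℝ) | Wξ ∈ L²(ℝ)}` with `Wξ` viewed as a tempered distribution".
[cite: ConnesMoscovici2022, §1 ¶1 and eq. (1.2) (= arXiv §2 ¶1, (2.2), chunk p0004:L16–L22)] -/
def prolateMax (lam : ℝ) : L2R →ₗ.[ℂ] L2R := (prolateCore lam).adjoint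

/-- RH-FREE object. **The anti-symmetric pairing `Ω`** on `dom W_max`:
`Ω(ξ, η) = (1/i)(⟨W_max ξ | η⟩ − ⟨ξ | W_max η⟩)` (inner product antilinear in the first slot, as
Mathlib's). [cite: ConnesMoscovici2022, §1 eq. (1.4) (= arXiv (2.4), chunk p0005:L16–L21)] -/
def omegaForm (lam : ℝ) (ξ η : (prolateMax lam).domain) : ℂ :=
  -I * (⟪prolateMax lam ξ, (η : L2R)⟫_ℂ - ⟪(ξ : L2R), prolateMax lam η⟫_ℂ)

/-- RH-FREE object. The generalized Wronskian `[ξ, η] = p (ξ η′ − η ξ′)`, `p = λ² − x²`, of the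
Lagrange identity `d/dx [ξ, η] = ξ Wη − η Wξ`. [cite: ConnesMoscovici2022, §1 eqs. (1.5)–(1.6) (= arXiv (2.5)–(2.6), chunk p0005:L24–L31)] -/
def wronskian (lam : ℝ) (f g : ℝ → ℂ) (x : ℝ) : ℂ :=
  pCoeff lam x * (f x * deriv g x - g x * deriv f x)

/-- RH-FREE object. "`W` commutes with `T`" for a partially defined `W` and a map `T` of `L²(ℝ)`:
`T` preserves `dom W` and `W (T ξ) = T (W ξ)`. [cite: ConnesMoscovici2022, Thm 1.6 (i)–(iii) (= arXiv Thm 2.6, chunk p0006:L76–L79)] -/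
def CommutesWith (W : L2R →ₗ.[ℂ] L2R) (T : L2R → L2R) : Prop :=
  ∀ ξ : W.domain, ∃ h : T ξ ∈ W.domain, W ⟨T ξ, h⟩ = T (W ξ)

/-- RH-FREE object. The unitary Fourier transform `𝔽_{e_ℝ} f(y) = ∫ f(x) e^{−2πixy} dx` on `L²(ℝ)`
(Mathlib's `𝓕` on `Lp ℂ 2`, same kernel). [cite: ConnesMoscovici2022, §1 eq. (1.3) (= arXiv (2.3), chunk p0004:L24–L26)] -/
def fourierL2 (ξ : L2R) : L2R := (𝓕 ξ : L2R)

/-! ## The boundary conditions defining `W_sa` -/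

/-- RH-FREE object. Even part `ξ⁺(x) = (ξ(x) + ξ(−x))/2` of a function. [cite: ConnesMoscovici2022, §1, text before Thm 1.6 (= arXiv chunk p0006:L60)] -/
def evenFn (g : ℝ → ℂ) (x : ℝ) : ℂ := (g x + g (-x)) / 2

/-- RH-FREE object. Odd part `ξ⁻(x) = (ξ(x) − ξ(−x))/2`. [cite: ConnesMoscovici2022, §1, text before Thm 1.6 (= arXiv chunk p0006:L60)] -/
def oddFn (g : ℝ → ℂ) (x : ℝ) : ℂ := (g x - g (-x)) / 2

/-- RH-FREE object. The even-sector boundary expression at `±∞`: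
`x sin(2πλx) ∂ₓξ⁺(x) − (2πλx cos(2πλx) − sin(2πλx)) ξ⁺(x)`. [cite: ConnesMoscovici2022, §1 boundary condition (1.20) (= arXiv (2.20), chunk p0006:L64–L66)] -/
def bcInfEven (lam : ℝ) (h : ℝ → ℂ) (x : ℝ) : ℂ :=
  (x * Real.sin (2 * π * lam * x) : ℝ) * deriv h x -
    ((2 * π * lam * x * Real.cos (2 * π * lam * x) - Real.sin (2 * π * lam * x) : ℝ) : ℂ) * h x

/-- RH-FREE object. The odd-sector boundary expression at `±∞`:
`x cos(2πλx) ∂ₓξ⁻(x) + (2πλx sin(2πλx) + cos(2πλx)) ξ⁻(x)`. [cite: ConnesMoscovici2022, §1 boundary condition (1.21) (= arXiv (2.21), chunk p0006:L67–L69)] -/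
def bcInfOdd (lam : ℝ) (h : ℝ → ℂ) (x : ℝ) : ℂ :=
  (x * Real.cos (2 * π * lam * x) : ℝ) * deriv h x +
    ((2 * π * lam * x * Real.sin (2 * π * lam * x) + Real.cos (2 * π * lam * x) : ℝ) : ℂ) * h x

/-- RH-FREE object. **The boundary conditions of `dom W_sa`, as printed** ("Explicitly, its domain
`dom W_sa` consists of the elements `ξ ∈ dom(W_max)` satisfying the following boundary conditions"):
(1.19) `lim_{x → ±λ} (λ² − x²) ∂ₓξ(x) = 0`, and at `±∞`, writing `ξ = ξ⁺ + ξ⁻`, (1.20) for the even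
part and (1.21) for the odd part — stated for a representative `g` differentiable off `{±λ}`.
[cite: ConnesMoscovici2022, §1 Definition before Thm 1.6, eqs. (1.19)–(1.21) (= arXiv (2.19)–(2.21), chunk p0006:L55–L69)] -/
structure ProlateBC (lam : ℝ) (g : ℝ → ℂ) : Prop where
  differentiableOn : DifferentiableOn ℝ g {x | x ≠ lam ∧ x ≠ -lam}
  atLam : Tendsto (fun x ↦ pCoeff lam x * deriv g x) (𝓝[{x | x ≠ lam ∧ x ≠ -lam}] lam) (𝓝 0)
  atNegLam :
    Tendsto (fun x ↦ pCoeff lam x * deriv g x) (𝓝[{x | x ≠ lam ∧ x ≠ -lam}] (-lam)) (𝓝 0)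
  evenTop : Tendsto (bcInfEven lam (evenFn g)) atTop (𝓝 0)
  evenBot : Tendsto (bcInfEven lam (evenFn g)) atBot (𝓝 0)
  oddTop : Tendsto (bcInfOdd lam (oddFn g)) atTop (𝓝 0)
  oddBot : Tendsto (bcInfOdd lam (oddFn g)) atBot (𝓝 0)

/-- RH-FREE object. The set `𝓛_β = dom W_sa ⊂ dom W_max` cut out by the boundary conditions
(1.19)–(1.21) on an a.e. representative. [cite: ConnesMoscovici2022, §1 Definition before Thm 1.6 (= arXiv chunk p0006:L52–L69)] -/
def prolateSASet (lam : ℝ) : Set L2R :=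
  {ξ | ξ ∈ (prolateMax lam).domain ∧ ∃ g : ℝ → ℂ, (ξ : ℝ → ℂ) =ᵐ[volume] g ∧ ProlateBC lam g}

/-- RH-FREE object. **`W_sa`**: "We denote by `W_sa` the restriction of the operator `W_max` to the
subspace `𝓛_β`" — the predicate "`W` is that restriction": `W ≤ W_max` (Mathlib's extension order
on `LinearPMap`) with `dom W = 𝓛_β`. [cite: ConnesMoscovici2022, §1 Definition before Thm 1.6 (= arXiv chunk p0006:L52–L55)] -/
def IsProlateSA (lam : ℝ) (W : L2R →ₗ.[ℂ] L2R) : Prop :=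
  W ≤ prolateMax lam ∧ (W.domain : Set L2R) = prolateSASet lam

/-- RH-FREE object. "The spectrum of `W` is discrete and unbounded on both sides", typed as: an
orthonormal eigenbasis (Mathlib `HilbertBasis`) with real eigenvalues `μ_n`, `|μ_n| → ∞`,
`{μ_n}` bounded neither above nor below. [cite: ConnesMoscovici2022, Thm 1.6 (iv) (= arXiv Thm 2.6 (iv), chunk p0006:L79)] -/
def HasDiscreteSpectrumUnboundedBothSides (W : L2R →ₗ.[ℂ] L2R) : Prop :=
  ∃ (b : HilbertBasis ℕ ℂ L2R) (μ : ℕ → ℝ),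
    (∀ n, ∃ h : (b n : L2R) ∈ W.domain, W ⟨b n, h⟩ = ((μ n : ℝ) : ℂ) • (b n : L2R)) ∧
    Tendsto (fun n ↦ |μ n|) atTop atTop ∧ ¬BddAbove (Set.range μ) ∧ ¬BddBelow (Set.range μ)

/-! ## §1 (= arXiv §2): the self-adjoint prolate wave operator -/

/-- NAMED FACT (RH-FREE). **Lemma 1.1** (= arXiv Lemma 2.1): "The deficiency indices of `W_min` are
`(4,4)`", i.e. `dim Ker(W_max ∓ i) = 4` (typed with the tree's `LinearPMap.eigenspace`).
[cite: ConnesMoscovici2022, Lemma 1.1 (= arXiv Lemma 2.1, chunk p0004:L39; proof L41–L48)] -/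
def CM22_lemma_1_1 : Prop :=
  ∀ lam : ℝ, 0 < lam →
    Module.finrank ℂ ((prolateMax lam).eigenspace I) = 4 ∧
      Module.finrank ℂ ((prolateMax lam).eigenspace (-I)) = 4 ∧
      FiniteDimensional ℂ ((prolateMax lam).eigenspace I) ∧
      FiniteDimensional ℂ ((prolateMax lam).eigenspace (-I))

/-- NAMED FACT (RH-FREE). **Lemma 1.2** (= arXiv Lemma 2.2): for `a = ±λ`, "the distribution
`p(x)∂ₓξ` coincides with a continuous function `f` in a neighborhood of `a` and the evaluation map
`L(ξ) := f(a)` defines a non-zero continuous linear form on `dom W_max` which vanishes on the closed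
subspace `dom W_min`" — typed as: there is a nonzero linear functional `L` on `dom W_max`, bounded
for the graph norm, vanishing on `dom W_min`, whose value on any `ξ` with a representative `g`
differentiable off `{±λ}` and `p g′ → c` at `a` is `c`.
[cite: ConnesMoscovici2022, Lemma 1.2 (= arXiv Lemma 2.2, chunk p0004:L50–L52; proof L54–L100)] -/
def CM22_lemma_1_2 : Prop :=
  ∀ lam : ℝ, 0 < lam → ∀ a ∈ ({lam, -lam} : Set ℝ),
    ∃ L : (prolateMax lam).domain →ₗ[ℂ] ℂ,
      L ≠ 0 ∧
      (∃ C : ℝ, ∀ ξ : (prolateMax lam).domain, ‖L ξ‖ ≤ C * (‖(ξ : L2R)‖ + ‖prolateMax lam ξ‖)) ∧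
      (∀ ξ : (prolateMax lam).domain, (ξ : L2R) ∈ (prolateMin lam).domain → L ξ = 0) ∧
      (∀ (ξ : (prolateMax lam).domain) (g : ℝ → ℂ) (c : ℂ),
        ((ξ : L2R) : ℝ → ℂ) =ᵐ[volume] g → DifferentiableOn ℝ g {x | x ≠ lam ∧ x ≠ -lam} →
        Tendsto (fun x ↦ pCoeff lam x * deriv g x) (𝓝[{x | x ≠ lam ∧ x ≠ -lam}] a) (𝓝 c) →
        L ξ = c)

/-- NAMED FACT (RH-FREE). **Lemma 1.3** (= arXiv Lemma 2.3): "If `ξ ∈ dom W_min` then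
`P_λ ξ ∈ dom W_max` and `W P_λ ξ = P_λ W ξ`. The same holds with respect to `P̂_λ`"
(`P_λ`, `P̂_λ` = the tree's `cutoffProj`, `cutoffProjHat`).
[cite: ConnesMoscovici2022, Lemma 1.3 (= arXiv Lemma 2.3, chunk p0004:L106–L108; proof p0004:L110–p0005:L14)] -/
def CM22_lemma_1_3 : Prop :=
  ∀ lam : ℝ, 0 < lam → ∀ ξ : (prolateMin lam).domain,
    (∃ h : cutoffProj lam ξ ∈ (prolateMax lam).domain,
        prolateMax lam ⟨cutoffProj lam ξ, h⟩ = cutoffProj lam (prolateMin lam ξ)) ∧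
    (∃ h : cutoffProjHat lam ξ ∈ (prolateMax lam).domain,
        prolateMax lam ⟨cutoffProjHat lam ξ, h⟩ = cutoffProjHat lam (prolateMin lam ξ))

/-- NAMED FACT (RH-FREE). **Lemma 1.4 (i)** (= arXiv Lemma 2.4 (i)): "Let
`f(x) = ½ log((λ² − x²)⁻²)` viewed as a tempered distribution. Then the Fourier transform `𝔽f` is a
distribution which coincides outside `0` with the function `cos(2πλy)/|y|`" — typed in weak form
against Schwartz functions supported away from `0` (Parseval pairing `⟨f, 𝓕φ⟩ = ⟨𝓕f, φ⟩`).
[cite: ConnesMoscovici2022, Lemma 1.4 (i) (= arXiv Lemma 2.4 (i), chunk p0005:L71–L74; proof L78–L81)] -/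
def CM22_lemma_1_4_i : Prop :=
  ∀ lam : ℝ, 0 < lam → ∀ φ : 𝓢(ℝ, ℂ), (0 : ℝ) ∉ tsupport φ →
    ∫ x : ℝ, (((1 / 2 : ℝ) * Real.log ((lam ^ 2 - x ^ 2) ^ 2)⁻¹ : ℝ) : ℂ) * 𝓕 (φ : ℝ → ℂ) x =
      ∫ y : ℝ, ((Real.cos (2 * π * lam * y) / |y| : ℝ) : ℂ) * φ y

/-- RH-FREE, PROVED. **Lemma 1.4 (ii)** (= arXiv Lemma 2.4 (ii)): "Let `1_I` be the characteristic
function of the interval `I = [−λ, λ]`, then `𝔽 1_I(y) = sin(2πλy)/(πy)`" (for `y ≠ 0`; kernel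
`e^{−2πixy}`, Mathlib's `𝓕`). [cite: ConnesMoscovici2022, Lemma 1.4 (ii) (= arXiv Lemma 2.4 (ii), chunk p0005:L75–L76; proof L81)] -/
theorem CM22_lemma_1_4_ii (lam : ℝ) (hlam : 0 < lam) {y : ℝ} (hy : y ≠ 0) :
    𝓕 ((Icc (-lam) lam).indicator fun _ : ℝ ↦ (1 : ℂ)) y =
      ((Real.sin (2 * π * lam * y) / (π * y) : ℝ) : ℂ) := by
  rw [Real.fourier_real_eq_integral_exp_smul]
  set c : ℂ := -(2 * π * y) * I with hc
  have hπy : ((π : ℂ) * y) ≠ 0 := by exact_mod_cast mul_ne_zero Real.pi_ne_zero hy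
  have hc0 : c ≠ 0 := by
    rw [hc]
    refine mul_ne_zero (neg_ne_zero.2 ?_) Complex.I_ne_zero
    rw [mul_assoc]
    exact mul_ne_zero two_ne_zero hπy
  have h1 : (fun v : ℝ ↦ Complex.exp (((-2 * π * v * y : ℝ) : ℂ) * I) •
      (Icc (-lam) lam).indicator (fun _ : ℝ ↦ (1 : ℂ)) v) =
      (Icc (-lam) lam).indicator fun v : ℝ ↦ Complex.exp (c * v) := by
    funext v
    by_cases hv : v ∈ Icc (-lam) lam
    · simp only [hv, Set.indicator_of_mem, smul_eq_mul, mul_one, hc]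
      congr 1
      push_cast
      ring
    · simp [hv]
  rw [h1, integral_indicator measurableSet_Icc, integral_Icc_eq_integral_Ioc,
    ← intervalIntegral.integral_of_le (by linarith), integral_exp_mul_complex hc0]
  -- (e^{cλ} - e^{-cλ})/c with c = -2πiy
  have h2 : Complex.exp (c * lam) - Complex.exp (c * (-lam : ℝ)) =
      -2 * I * Complex.sin (2 * π * lam * y) := by
    rw [Complex.sin, hc]
    push_cast
    have e1 : -(2 * (π : ℂ) * y) * I * lam = -(2 * π * lam * y) * I := by ring
    have e2 : -(2 * (π : ℂ) * y) * I * -(lam : ℂ) = 2 * π * lam * y * I := by ring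
    rw [e1, e2]
    have hI : I * I = -1 := Complex.I_mul_I
    linear_combination (Complex.exp (-(2 * ↑π * ↑lam * ↑y) * I) - Complex.exp (2 * ↑π * ↑lam * ↑y * I)) * hI
  rw [h2, div_eq_iff hc0, hc]
  push_cast
  rw [div_mul_eq_mul_div, eq_div_iff hπy]
  ring

/-- NAMED FACT (RH-FREE). **Lemma 1.5** (= arXiv Lemma 2.5): with `α₊ ∈ C_c^∞(ℝ)` even,
`α₊(x) = log|λ² − x²|` for `x ∈ [¾λ, ⁵⁄₄λ]`, supported in `(½λ, ³⁄₂λ)` (on `x ≥ 0`), `β₊ = 1_I`,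
`α₋ = xα₊`, `β₋ = xβ₊`: "The quadruplet `{α±, β±, α̂±, β̂±}` forms a basis of `ℰ± `",
`ℰ = dom(W_max)/dom(W_min)` — typed: the eight vectors lie in `dom W_max` and every
`ξ ∈ dom W_max` differs from a UNIQUE linear combination of them by an element of `dom W_min`.
[cite: ConnesMoscovici2022, Lemma 1.5 (= arXiv Lemma 2.5, chunk p0005:L84–L92; proof L94–L104)] -/
def CM22_lemma_1_5 : Prop :=
  ∀ lam : ℝ, 0 < lam →
  ∀ (α : ℝ → ℝ), ContDiff ℝ (⊤ : ℕ∞) α → (∀ x, α (-x) = α x) →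
    (∀ x ∈ Icc (3 / 4 * lam) (5 / 4 * lam), α x = Real.log |lam ^ 2 - x ^ 2|) →
    (∀ x, 0 ≤ x → α x ≠ 0 → x ∈ Ioo (lam / 2) (3 / 2 * lam)) →
  ∀ (αp αm βp βm : L2R),
    ((αp : ℝ → ℂ) =ᵐ[volume] fun x ↦ (α x : ℂ)) →
    ((αm : ℝ → ℂ) =ᵐ[volume] fun x ↦ (x * α x : ℂ)) →
    ((βp : ℝ → ℂ) =ᵐ[volume] (Icc (-lam) lam).indicator fun _ ↦ (1 : ℂ)) →
    ((βm : ℝ → ℂ) =ᵐ[volume] (Icc (-lam) lam).indicator fun x ↦ (x : ℂ)) →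
    let v : Fin 8 → L2R := ![αp, αm, βp, βm, fourierL2 αp, fourierL2 αm, fourierL2 βp, fourierL2 βm]
    (∀ i, v i ∈ (prolateMax lam).domain) ∧
    ∀ ξ ∈ (prolateMax lam).domain, ∃! c : Fin 8 → ℂ, ξ - ∑ i, c i • v i ∈ (prolateMin lam).domain

/-- NAMED FACT (RH-FREE). **Theorem 1.6** (= arXiv Theorem 2.6): "(i) `W_sa` is selfadjoint and
commutes with the Fourier transform. (ii) `W_sa` commutes with the projections `P_λ` and `P̂_λ`.
(iii) `W_sa` is the only selfadjoint extension of `W_min` commuting with `P_λ` and `P̂_λ`. (iv) The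
spectrum of `W_sa` is discrete and unbounded on both sides."  First clause: the printed Definition
of `W_sa` is well posed (some `W` with `IsProlateSA lam W` exists, i.e. the boundary conditions cut
out a linear subspace of `dom W_max`).
[cite: ConnesMoscovici2022, Thm 1.6 (= arXiv Thm 2.6, chunk p0006:L76–L79; proof L81–L114)] -/
def CM22_thm_1_6 : Prop :=
  ∀ lam : ℝ, 0 < lam →
    (∃ W, IsProlateSA lam W) ∧
    ∀ W : L2R →ₗ.[ℂ] L2R, IsProlateSA lam W →
      IsSelfAdjoint W ∧ CommutesWith W fourierL2 ∧
      CommutesWith W (cutoffProj lam) ∧ CommutesWith W (cutoffProjHat lam) ∧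
      (∀ W' : L2R →ₗ.[ℂ] L2R, IsSelfAdjoint W' → prolateMin lam ≤ W' →
        CommutesWith W' (cutoffProj lam) → CommutesWith W' (cutoffProjHat lam) → W' = W) ∧
      HasDiscreteSpectrumUnboundedBothSides W

/-- NAMED FACT (RH-FREE). **Corollary 1.7** (= arXiv Corollary 2.7): "If `φ` is an eigenfunction
of `W_sa^±` then (i) `φ` is regular on `[λ, λ+ε)` and on `(λ−ε, λ]` for some `ε > 0`, with a possible
discontinuity at `λ`; (ii) the leading term of the asymptotic expansion of `φ` at `∞` is
proportional to `sin(2πλx)/x` if `φ` is even and to `cos(2πλx)/x` if `φ` is odd" — typed on a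
representative: smooth on `(λ, λ+ε)` and `(λ−ε, λ)` with one-sided limits at `λ` (WEAKER than
"regular", which in print means analytic up to the endpoint), and
`φ(x) − c·sin(2πλx)/x = o(1/x)` (resp. `cos`) at `+∞`.
[cite: ConnesMoscovici2022, Cor 1.7 (= arXiv Cor 2.7, chunk p0006:L116–L123; proof chunk p0007:L1–L4)] -/
def CM22_cor_1_7 : Prop :=
  ∀ lam : ℝ, 0 < lam → ∀ W : L2R →ₗ.[ℂ] L2R, IsProlateSA lam W →
    ∀ (μ : ℝ) (φ : L2R), W.HasEigenvector (μ : ℂ) φ →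
      ∃ g : ℝ → ℂ, (φ : ℝ → ℂ) =ᵐ[volume] g ∧
        (∃ ε > 0, ContDiffOn ℝ (⊤ : ℕ∞) g (Ioo lam (lam + ε)) ∧
          ContDiffOn ℝ (⊤ : ℕ∞) g (Ioo (lam - ε) lam) ∧
          (∃ c, Tendsto g (𝓝[>] lam) (𝓝 c)) ∧ ∃ c, Tendsto g (𝓝[<] lam) (𝓝 c)) ∧
        ((∀ᵐ x : ℝ, g (-x) = g x) →
          ∃ c : ℂ, (fun x ↦ g x - c * ((Real.sin (2 * π * lam * x) / x : ℝ) : ℂ)) =o[atTop]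
            fun x ↦ (x⁻¹ : ℝ)) ∧
        ((∀ᵐ x : ℝ, g (-x) = -g x) →
          ∃ c : ℂ, (fun x ↦ g x - c * ((Real.cos (2 * π * lam * x) / x : ℝ) : ℂ)) =o[atTop]
            fun x ↦ (x⁻¹ : ℝ))

/-! ## §2 (= arXiv §3): Sonin space and negative eigenvalues (`λ = 1`, even functions) -/

/-- NAMED FACT (RH-FREE). **Corollary 2.2** (= arXiv Corollary 3.2): "assume `μ` is a negative
eigenvalue. Then `φ_μ` belongs to the Sonin space" (`λ = 1`, even functions; `φ_μ` = the even function
vanishing on `[−1,1]` and equal to the regular solution `f_μ` outside, which — by the boundary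
condition (1.19) and the positivity of the interior prolate eigenvalues — is, up to a scalar, THE even
eigenvector for `μ < 0`).  Typed on the eigenvector: every even eigenvector of `W_sa` (`λ = 1`) with
negative eigenvalue lies in Sonin's space `S(1,1)` (the tree's `soninSpace 1 1`).  "In fact Sonin's
space is the orthogonal of the eigenspaces of `W_sa` associated to the classical prolate functions and
their Fourier transforms."
[cite: ConnesMoscovici2022, Cor 2.2 (= arXiv Cor 3.2, chunk p0008:L79–L84)] -/
def CM22_cor_2_2 : Prop :=
  ∀ W : L2R →ₗ.[ℂ] L2R, IsProlateSA 1 W →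
    ∀ (μ : ℝ), μ < 0 → ∀ φ : L2R, W.HasEigenvector (μ : ℂ) φ →
      (∀ᵐ x : ℝ, (φ : ℝ → ℂ) (-x) = (φ : ℝ → ℂ) x) → φ ∈ soninSpace 1 1

/-! ## §3 (= arXiv §4): semiclassical approximation and counting function -/

/-- RH-FREE object. The complete elliptic integral `E(m) := ∫₀^{π/2} √(1 − m sin²θ) dθ`, AS PRINTED
(Mathlib has no elliptic integrals). [cite: ConnesMoscovici2022, §3, display before Lemma 3.1 (= arXiv §4, chunk p0009:L43–L46)] -/
def ellipticE (m : ℝ) : ℝ := ∫ θ in (0 : ℝ)..(π / 2), Real.sqrt (1 - m * Real.sin θ ^ 2)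

/-- RH-FREE object. `K(m) := ∫₀^{π/2} dθ/√(1 − m sin²θ)`, AS PRINTED. [cite: ConnesMoscovici2022, §3, display before Lemma 3.1 (= arXiv §4, chunk p0009:L43–L46)] -/
def ellipticK (m : ℝ) : ℝ := ∫ θ in (0 : ℝ)..(π / 2), 1 / Real.sqrt (1 - m * Real.sin θ ^ 2)

/-- RH-FREE object. `I(a) = I₁(a) := ∫₁^∞ (√(a + y² − 1)/√(y² − 1) − 1) dy`.
[cite: ConnesMoscovici2022, §3, displays before Lemma 3.1 (= arXiv §4, chunk p0009:L22–L35)] -/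
def cmAreaIntegral (a : ℝ) : ℝ :=
  ∫ y in Ioi (1 : ℝ), (Real.sqrt (a + y ^ 2 - 1) / Real.sqrt (y ^ 2 - 1) - 1)

/-- RH-FREE object. `I_λ(a) := ∫_λ^∞ (√(a + λ²x² − λ⁴)/√(x² − λ²) − λ) dx`, the area of `Ω_λ(E)` for
`a = (E/2π)² + λ⁴`. [cite: ConnesMoscovici2022, §3, display before (3.3) (= arXiv §4, chunk p0009:L22–L26)] -/
def cmAreaIntegralLam (lam a : ℝ) : ℝ :=
  ∫ x in Ioi lam, (Real.sqrt (a + lam ^ 2 * x ^ 2 - lam ^ 4) / Real.sqrt (x ^ 2 - lam ^ 2) - lam)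

/-- RH-FREE object. The classical Hamiltonian `H_λ(p, q) = (p² − λ²)(q² − λ²)`.
[cite: ConnesMoscovici2022, §3 eq. (3.1) (= arXiv (4.1), chunk p0009:L5–L8)] -/
def cmHamiltonian (lam p q : ℝ) : ℝ := (p ^ 2 - lam ^ 2) * (q ^ 2 - lam ^ 2)

/-- RH-FREE object. The region `Ω_λ(E) = {(q,p) | q ≥ λ, p ≥ λ, H_λ(p,q) ≤ (E/2π)² + λ⁴}` (points
typed as `(q, p)`). [cite: ConnesMoscovici2022, §3, display after (3.2) (= arXiv §4, chunk p0009:L14–L18)] -/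
def cmRegion (lam E : ℝ) : Set (ℝ × ℝ) :=
  {z | lam ≤ z.1 ∧ lam ≤ z.2 ∧ cmHamiltonian lam z.2 z.1 ≤ (E / (2 * π)) ^ 2 + lam ^ 4}

/-- RH-FREE object. `σ(E, λ) :=` the area of `Ω_λ(E)` ("the semiclassical approximation
corresponds, for the restriction to even functions (or to odd functions), to twice the area of
`Ω_λ(E)`", so the semiclassical count per parity sector is `2σ(E,λ)`, Prop 3.2).
[cite: ConnesMoscovici2022, Prop 3.2 and the sentence after it (= arXiv Prop 4.2, chunk p0009:L74–L82)] -/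
def cmSigma (E lam : ℝ) : ℝ := (volume (cmRegion lam E)).toReal

/-- RH-FREE object. The printed main term of `σ`:
`(E/2π)(log(E/2π) − 1 + log 4 − 2 log λ) + λ²`. [cite: ConnesMoscovici2022, Prop 3.2 eq. (3.5) (= arXiv (4.5), chunk p0009:L76–L80)] -/
def cmSigmaMain (E lam : ℝ) : ℝ :=
  E / (2 * π) * (Real.log (E / (2 * π)) - 1 + Real.log 4 - 2 * Real.log lam) + lam ^ 2

/-- NAMED FACT (RH-FREE) — DISCHARGED below (`CM22_eq_3_3_holds`). The area of `Ω_λ(E)` "is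
given, with `a = (E/2π)² + λ⁴`, by the convergent integral `I_λ(a)`", and the scaling **(3.3)**
`I_λ(a) = λ² I₁(aλ⁻⁴)` (substitution `x = λy`). [cite: ConnesMoscovici2022, §3 eq. (3.3) and the two displays before it (= arXiv (4.3), chunk p0009:L20–L35)] -/
def CM22_eq_3_3 : Prop :=
  ∀ lam E : ℝ, 0 < lam → 0 ≤ E →
    cmSigma E lam = cmAreaIntegralLam lam ((E / (2 * π)) ^ 2 + lam ^ 4) ∧
    ∀ a : ℝ, lam ^ 4 ≤ a → cmAreaIntegralLam lam a = lam ^ 2 * cmAreaIntegral (a * (lam ^ 4)⁻¹)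

/-- NAMED FACT (RH-FREE) — DISCHARGED below (`CM22_lemma_3_1_holds`). **Lemma 3.1** (= arXiv
Lemma 4.1): "The integral `I(a) = I₁(a)` is given by the sum of elliptic integrals
`I(a) = a K(1−a) − E(1−a) + 1`" (for `a ≥ 1`, the range used).
[cite: ConnesMoscovici2022, Lemma 3.1 eq. (3.4) (= arXiv Lemma 4.1 (4.4), chunk p0009:L48–L52; proof L54–L70)] -/
def CM22_lemma_3_1 : Prop :=
  ∀ a : ℝ, 1 ≤ a → cmAreaIntegral a = a * ellipticK (1 - a) - ellipticE (1 - a) + 1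

/-- NAMED FACT (RH-FREE; a SEMICLASSICAL statement: about the phase-space area `σ`, not about the true
eigenvalue count). **Proposition 3.2** (= arXiv Prop 4.2): "The semiclassical approximation to the
number of negative eigenvalues `ξ` of `W_sa` with `−ξ ≤ E²` on even functions is the same as on odd
functions and is equal to `2σ(E,λ)` where
`σ(E,λ) ∼ (E/2π)(log(E/2π) − 1 + log 4 − 2 log λ) + λ² + o(1)`" — typed as the asymptotic of the
area `σ = cmSigma` (proof in print: (3.3), Lemma 3.1 and the expansion (3.6) of `I(a)` as `a → ∞`).
[cite: ConnesMoscovici2022, Prop 3.2 eq. (3.5) (= arXiv Prop 4.2 (4.5), chunk p0009:L74–L80; proof L82–L100)] -/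
def CM22_prop_3_2 : Prop :=
  ∀ lam : ℝ, 0 < lam → Tendsto (fun E ↦ cmSigma E lam - cmSigmaMain E lam) atTop (𝓝 0)

/-! ### Discharge of (3.3) (area of `Ω_λ(E)` and scaling, RH-FREE)

Cavalieri over `q`: for `q = x > λ` the `p`-section of `Ω_λ(E)` is `[λ, √(λ² + a/(x² − λ²))]`, of
length `√(a + λ²x² − λ⁴)/√(x² − λ²) − λ`; `Measure.prod_apply` + `integral_eq_lintegral_of_nonneg_ae`
give the area clause with no convergence hypothesis (both sides carry the same junk value `0` if the
integral diverged).  The scaling is the substitution `x = λy`.  Helper names are private. -/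

section Area

/-- `Ω_λ(E)` is closed (hence measurable). [folklore] -/
private theorem isClosed_cmRegion (lam E : ℝ) : IsClosed (cmRegion lam E) := by
  have h1 : IsClosed {z : ℝ × ℝ | lam ≤ z.1} := isClosed_le continuous_const continuous_fst
  have h2 : IsClosed {z : ℝ × ℝ | lam ≤ z.2} := isClosed_le continuous_const continuous_snd
  have h3 : IsClosed {z : ℝ × ℝ | cmHamiltonian lam z.2 z.1 ≤ (E / (2 * π)) ^ 2 + lam ^ 4} := by
    refine isClosed_le ?_ continuous_const
    unfold cmHamiltonian
    fun_prop
  have : cmRegion lam E = {z : ℝ × ℝ | lam ≤ z.1} ∩ ({z : ℝ × ℝ | lam ≤ z.2} ∩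
      {z : ℝ × ℝ | cmHamiltonian lam z.2 z.1 ≤ (E / (2 * π)) ^ 2 + lam ^ 4}) := by
    ext z; simp [cmRegion]
  rw [this]
  exact h1.inter (h2.inter h3)

/-- The `p`-section of `Ω_λ(E)` over `q = x > λ` is `[λ, √(λ² + a/(x² − λ²))]`,
`a = (E/2π)² + λ⁴` (solve `(p² − λ²)(x² − λ²) ≤ a` for `p ≥ λ`). [folklore] -/
private theorem cmRegion_section_eq {lam E : ℝ} (hlam : 0 < lam) {x : ℝ} (hx : lam < x) :
    Prod.mk x ⁻¹' cmRegion lam E =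
      Icc lam (Real.sqrt (lam ^ 2 + ((E / (2 * π)) ^ 2 + lam ^ 4) / (x ^ 2 - lam ^ 2))) := by
  set a : ℝ := (E / (2 * π)) ^ 2 + lam ^ 4 with ha
  have ha0 : 0 ≤ a := by positivity
  have hden : 0 < x ^ 2 - lam ^ 2 := by nlinarith
  have hR2 : Real.sqrt (lam ^ 2 + a / (x ^ 2 - lam ^ 2)) ^ 2 = lam ^ 2 + a / (x ^ 2 - lam ^ 2) :=
    Real.sq_sqrt (by positivity)
  ext p
  simp only [mem_preimage, cmRegion, cmHamiltonian, mem_setOf_eq, mem_Icc]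
  constructor
  · rintro ⟨-, hp, h3⟩
    have hp0 : 0 ≤ p := hlam.le.trans hp
    refine ⟨hp, (Real.le_sqrt hp0 (by positivity)).2 ?_⟩
    have := (le_div_iff₀ hden).2 h3
    linarith
  · rintro ⟨hp, hpR⟩
    have hp0 : 0 ≤ p := hlam.le.trans hp
    refine ⟨hx.le, hp, ?_⟩
    have h1 : p ^ 2 ≤ lam ^ 2 + a / (x ^ 2 - lam ^ 2) := by
      have := pow_le_pow_left₀ hp0 hpR 2
      rwa [hR2] at this
    exact (le_div_iff₀ hden).1 (by linarith)

/-- No `p`-section over `q = x < λ`. [folklore] -/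
private theorem cmRegion_section_empty {lam E : ℝ} {x : ℝ} (hx : x < lam) :
    Prod.mk x ⁻¹' cmRegion lam E = ∅ := by
  ext p
  simp only [mem_preimage, cmRegion, mem_setOf_eq, mem_empty_iff_false, iff_false, not_and]
  intro h
  exact absurd h (not_le.2 hx)

/-- `√(λ² + a/(x² − λ²)) = √(a + λ²x² − λ⁴)/√(x² − λ²)` for `x > λ`. [folklore] -/
private theorem sqrt_section_len {lam a x : ℝ} (hx : lam < x) (hlam : 0 < lam) :
    Real.sqrt (lam ^ 2 + a / (x ^ 2 - lam ^ 2)) =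
      Real.sqrt (a + lam ^ 2 * x ^ 2 - lam ^ 4) / Real.sqrt (x ^ 2 - lam ^ 2) := by
  have hden : 0 < x ^ 2 - lam ^ 2 := by nlinarith
  have : lam ^ 2 + a / (x ^ 2 - lam ^ 2) = (a + lam ^ 2 * x ^ 2 - lam ^ 4) / (x ^ 2 - lam ^ 2) := by
    field_simp
    ring
  rw [this, Real.sqrt_div' _ hden.le]

/-- The integrand of `I_λ(a)` is `≥ 0` on `(λ, ∞)` when `a ≥ 0`. [folklore] -/
private theorem cmAreaIntegrand_nonneg {lam a x : ℝ} (hx : lam < x) (hlam : 0 < lam) (ha : 0 ≤ a) :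
    0 ≤ Real.sqrt (a + lam ^ 2 * x ^ 2 - lam ^ 4) / Real.sqrt (x ^ 2 - lam ^ 2) - lam := by
  rw [← sqrt_section_len hx hlam, sub_nonneg]
  have hden : 0 < x ^ 2 - lam ^ 2 := by nlinarith
  calc lam = Real.sqrt (lam ^ 2) := (Real.sqrt_sq hlam.le).symm
    _ ≤ Real.sqrt (lam ^ 2 + a / (x ^ 2 - lam ^ 2)) :=
        Real.sqrt_le_sqrt (le_add_of_nonneg_right (by positivity))

/-- RH-FREE, PROVED (first clause of (3.3), for every real `E`): the area of `Ω_λ(E)` equals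
`I_λ(a)`, `a = (E/2π)² + λ⁴` — Cavalieri (`Measure.prod_apply`) over the `q`-sections
`[λ, √(λ² + a/(q² − λ²))]`; both sides are typed with the same junk value if the integral diverged, so
no convergence claim is needed or made.
[cite: ConnesMoscovici2022, §3, the two displays before (3.3) (= arXiv §4, chunk p0009:L20–L26)] -/
theorem cmSigma_eq_cmAreaIntegralLam {lam : ℝ} (E : ℝ) (hlam : 0 < lam) :
    cmSigma E lam = cmAreaIntegralLam lam ((E / (2 * π)) ^ 2 + lam ^ 4) := by
  set a : ℝ := (E / (2 * π)) ^ 2 + lam ^ 4 with ha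
  have ha0 : 0 ≤ a := by positivity
  set g : ℝ → ℝ := fun x ↦ Real.sqrt (a + lam ^ 2 * x ^ 2 - lam ^ 4) / Real.sqrt (x ^ 2 - lam ^ 2) - lam
    with hg
  have hmeas : MeasurableSet (cmRegion lam E) := (isClosed_cmRegion lam E).measurableSet
  unfold cmSigma cmAreaIntegralLam
  rw [Measure.volume_eq_prod, Measure.prod_apply hmeas]
  have hae : (fun x ↦ volume (Prod.mk x ⁻¹' cmRegion lam E)) =ᵐ[volume]
      (Ioi lam).indicator (fun x ↦ ENNReal.ofReal (g x)) := by
    have hne : ∀ᵐ x : ℝ ∂volume, x ≠ lam := by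
      have h0 : volume ({lam} : Set ℝ) = 0 := measure_singleton lam
      filter_upwards [compl_mem_ae_iff.2 h0] with x hx
      simpa using hx
    filter_upwards [hne] with x hx
    rcases lt_or_gt_of_ne hx with hlt | hgt
    · rw [cmRegion_section_empty hlt, measure_empty, Set.indicator_of_notMem (by simpa using hlt.le)]
    · rw [cmRegion_section_eq hlam hgt, Real.volume_Icc, Set.indicator_of_mem (mem_Ioi.2 hgt), hg]
      simp only
      rw [sqrt_section_len hgt hlam]
  rw [lintegral_congr_ae hae, lintegral_indicator measurableSet_Ioi]
  have hnn : 0 ≤ᵐ[volume.restrict (Ioi lam)] g := by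
    rw [Filter.EventuallyLE, ae_restrict_iff' measurableSet_Ioi]
    exact ae_of_all _ fun x hx ↦ cmAreaIntegrand_nonneg hx hlam ha0
  have hgm : Measurable g := by
    rw [hg]; fun_prop
  rw [integral_eq_lintegral_of_nonneg_ae hnn hgm.aestronglyMeasurable]

/-- RH-FREE, PROVED (the scaling **(3.3)**, for every real `a`): `I_λ(a) = λ² I₁(aλ⁻⁴)` by the
substitution `x = λy` (`integral_comp_mul_left_Ioi`).
[cite: ConnesMoscovici2022, §3 eq. (3.3) (= arXiv (4.3), chunk p0009:L28–L35)] -/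
theorem cmAreaIntegralLam_eq_mul_cmAreaIntegral {lam : ℝ} (hlam : 0 < lam) (a : ℝ) :
    cmAreaIntegralLam lam a = lam ^ 2 * cmAreaIntegral (a * (lam ^ 4)⁻¹) := by
  unfold cmAreaIntegralLam cmAreaIntegral
  have h := integral_comp_mul_left_Ioi
    (fun x ↦ Real.sqrt (a + lam ^ 2 * x ^ 2 - lam ^ 4) / Real.sqrt (x ^ 2 - lam ^ 2) - lam) 1 hlam
  rw [mul_one] at h
  have h2 : ∫ x in Ioi lam, (Real.sqrt (a + lam ^ 2 * x ^ 2 - lam ^ 4) / Real.sqrt (x ^ 2 - lam ^ 2) - lam)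
      = lam * ∫ y in Ioi (1 : ℝ), (Real.sqrt (a + lam ^ 2 * (lam * y) ^ 2 - lam ^ 4) /
          Real.sqrt ((lam * y) ^ 2 - lam ^ 2) - lam) := by
    rw [h, smul_eq_mul, ← mul_assoc, mul_inv_cancel₀ hlam.ne', one_mul]
  rw [h2]
  have key : EqOn (fun y : ℝ ↦ Real.sqrt (a + lam ^ 2 * (lam * y) ^ 2 - lam ^ 4) /
        Real.sqrt ((lam * y) ^ 2 - lam ^ 2) - lam)
      (fun y ↦ lam * (Real.sqrt (a * (lam ^ 4)⁻¹ + y ^ 2 - 1) / Real.sqrt (y ^ 2 - 1) - 1)) (Ioi 1) := by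
    intro y hy
    have hy1 : 0 < y ^ 2 - 1 := by
      have : (1 : ℝ) < y := hy
      nlinarith
    have hs : Real.sqrt (y ^ 2 - 1) ≠ 0 := (Real.sqrt_pos.2 hy1).ne'
    have e1 : (lam * y) ^ 2 - lam ^ 2 = lam ^ 2 * (y ^ 2 - 1) := by ring
    have e2 : a + lam ^ 2 * (lam * y) ^ 2 - lam ^ 4 = (lam ^ 2) ^ 2 * (a * (lam ^ 4)⁻¹ + y ^ 2 - 1) := by
      field_simp
    simp only
    rw [e1, e2, Real.sqrt_mul (by positivity), Real.sqrt_mul (by positivity),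
      Real.sqrt_sq (by positivity), Real.sqrt_sq hlam.le]
    field_simp
  rw [setIntegral_congr_fun measurableSet_Ioi key, integral_const_mul]
  ring

/-- RH-FREE, PROVED: discharge of the named fact `CM22_eq_3_3` (area of `Ω_λ(E)` `= I_λ(a)` and
the scaling (3.3) `I_λ(a) = λ² I₁(aλ⁻⁴)`).
[cite: ConnesMoscovici2022, §3 eq. (3.3) and the two displays before it (= arXiv (4.3), chunk p0009:L20–L35)] -/
theorem CM22_eq_3_3_holds : CM22_eq_3_3 :=
  fun _lam E hlam _ ↦
    ⟨cmSigma_eq_cmAreaIntegralLam E hlam, fun a _ ↦ cmAreaIntegralLam_eq_mul_cmAreaIntegral hlam a⟩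

end Area

/-! ### Discharge of Lemma 3.1 (`I(a) = aK(1−a) − E(1−a) + 1`, RH-FREE)

Printed proof (arXiv chunk p0009:L54–L70): `x = 1/t` gives `I(a) = ∫₀¹ (√(1−mt²)/√(1−t²) − 1) dt/t²`,
`m = 1 − a`, and an explicit `g` with `g(0) = g(1) = 0`,
`g′ = −(integrand) + (1−m)/(√(1−t²)√(1−mt²)) − √(1−mt²)/√(1−t²) + 1`.  Here the further substitution
`t = sin θ` is made at once (`y = 1/sin θ`, `θ ∈ (0, π/2)`), so that all integrals are proper:
`I(a) = ∫₀^{π/2} a/(√S + cos θ) dθ` with `S = 1 − m sin²θ` (note `(√S − cos θ)(√S + cos θ) = a sin²θ`),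
`g(sin θ) = a sin θ cos θ/(√S + cos θ)`, and `d/dθ g(sin θ) = a/√S − √S + cos θ − a/(√S + cos θ)`,
whose integral over `[0, π/2]` vanishes; `∫₀^{π/2} cos = 1`.  Helper names are private. -/

section EllipticIntegral

variable {a : ℝ}

/-- `S(θ) = 1 − (1 − a) sin²θ ≥ 1` for `a ≥ 1`. [folklore] -/
private theorem one_le_ellS (ha : 1 ≤ a) (θ : ℝ) : 1 ≤ 1 - (1 - a) * Real.sin θ ^ 2 := by
  nlinarith [sq_nonneg (Real.sin θ)]

/-- `√S(θ) > 0`. [folklore] -/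
private theorem sqrt_ellS_pos (ha : 1 ≤ a) (θ : ℝ) : 0 < Real.sqrt (1 - (1 - a) * Real.sin θ ^ 2) :=
  Real.sqrt_pos.2 (by linarith [one_le_ellS ha θ])

/-- `θ ↦ 1/sin θ` maps `(0, π/2)` onto `(1, ∞)`. [folklore] -/
private theorem image_inv_sin_Ioo : (fun θ : ℝ ↦ (Real.sin θ)⁻¹) '' Ioo 0 (π / 2) = Ioi 1 := by
  ext y
  constructor
  · rintro ⟨θ, ⟨h0, h1⟩, rfl⟩
    have hs : 0 < Real.sin θ := Real.sin_pos_of_pos_of_lt_pi h0 (by linarith [Real.pi_pos])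
    have hlt : Real.sin θ < 1 := by
      rw [← Real.sin_pi_div_two]
      exact Real.strictMonoOn_sin ⟨by linarith [Real.pi_pos], h1.le⟩
        ⟨by linarith [Real.pi_pos], le_rfl⟩ h1
    exact (one_lt_inv₀ hs).2 hlt
  · intro hy
    have hy1 : (1 : ℝ) < y := hy
    have hy0 : 0 < y := lt_trans one_pos hy1
    have hi0 : 0 < y⁻¹ := inv_pos.2 hy0
    have hi1 : y⁻¹ < 1 := inv_lt_one_of_one_lt₀ hy1
    refine ⟨Real.arcsin y⁻¹, ⟨Real.arcsin_pos.2 hi0, Real.arcsin_lt_pi_div_two.2 hi1⟩, ?_⟩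
    simp only
    rw [Real.sin_arcsin (by linarith) hi1.le, inv_inv]

/-- The substitution `y = 1/sin θ`: `I(a) = ∫₀^{π/2} a/(√(1 − (1−a)sin²θ) + cos θ) dθ`
(as a set integral over `(0, π/2)`; change of variables `integral_image_eq_integral_abs_deriv_smul`,
then `(√S − cos θ)/sin²θ = a/(√S + cos θ)`). [folklore] -/
private theorem cmAreaIntegral_eq_integral_theta (ha : 1 ≤ a) :
    cmAreaIntegral a = ∫ θ in Ioo 0 (π / 2),
      a / (Real.sqrt (1 - (1 - a) * Real.sin θ ^ 2) + Real.cos θ) := by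
  unfold cmAreaIntegral
  rw [← image_inv_sin_Ioo]
  rw [integral_image_eq_integral_abs_deriv_smul measurableSet_Ioo
    (f' := fun θ ↦ -Real.cos θ / Real.sin θ ^ 2)
    (fun θ hθ ↦ ((Real.hasDerivAt_sin θ).fun_inv
      (Real.sin_pos_of_pos_of_lt_pi hθ.1 (by linarith [hθ.2, Real.pi_pos])).ne').hasDerivWithinAt)
    (fun θ₁ h₁ θ₂ h₂ h ↦ Real.injOn_sin ⟨by linarith [h₁.1, Real.pi_pos], h₁.2.le⟩
      ⟨by linarith [h₂.1, Real.pi_pos], h₂.2.le⟩ (inv_inj.1 h))]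
  refine setIntegral_congr_fun measurableSet_Ioo fun θ hθ ↦ ?_
  obtain ⟨h0, h1⟩ := hθ
  have hs : 0 < Real.sin θ := Real.sin_pos_of_pos_of_lt_pi h0 (by linarith [Real.pi_pos])
  have hc : 0 < Real.cos θ := Real.cos_pos_of_mem_Ioo ⟨by linarith, h1⟩
  have hr := sqrt_ellS_pos ha θ
  have hS := one_le_ellS ha θ
  have hsc : Real.sin θ ^ 2 + Real.cos θ ^ 2 = 1 := Real.sin_sq_add_cos_sq θ
  set s := Real.sin θ with hs_def
  set c := Real.cos θ with hc_def
  have hr2 : Real.sqrt (1 - (1 - a) * s ^ 2) ^ 2 = 1 - (1 - a) * s ^ 2 := Real.sq_sqrt (by linarith)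
  set r := Real.sqrt (1 - (1 - a) * s ^ 2) with hr_def
  have hrc : r + c ≠ 0 := by positivity
  rw [abs_div, abs_neg, abs_of_pos hc, abs_of_pos (pow_pos hs 2), smul_eq_mul]
  have e1 : Real.sqrt (s⁻¹ ^ 2 - 1) = c / s := by
    rw [show s⁻¹ ^ 2 - 1 = c ^ 2 / s ^ 2 by
        rw [show c ^ 2 = 1 - s ^ 2 by linarith]; field_simp,
      ← div_pow, Real.sqrt_sq (div_nonneg hc.le hs.le)]
  have e2 : Real.sqrt (a + s⁻¹ ^ 2 - 1) = r / s := by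
    rw [show a + s⁻¹ ^ 2 - 1 = r ^ 2 / s ^ 2 by rw [hr2]; field_simp; ring, ← div_pow,
      Real.sqrt_sq (div_nonneg hr.le hs.le)]
  rw [e1, e2]
  have key : (r - c) * (r + c) = a * s ^ 2 := by linear_combination hr2 - hsc
  have e3 : c / s ^ 2 * (r / s / (c / s) - 1) = (r - c) * (r + c) / (s ^ 2 * (r + c)) := by
    field_simp
  rw [e3, key]
  field_simp

/-- The boundary-term identity of the printed proof (`∫₀¹ g′ = 0` with
`g(sin θ) = a sin θ cos θ/(√S + cos θ)`): `∫₀^{π/2} (a/√S − √S + cos θ − a/(√S + cos θ)) dθ = 0`.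
[folklore] -/
private theorem integral_boundary_term (ha : 1 ≤ a) :
    ∫ θ in (0 : ℝ)..(π / 2), (a / Real.sqrt (1 - (1 - a) * Real.sin θ ^ 2)
      - Real.sqrt (1 - (1 - a) * Real.sin θ ^ 2) + Real.cos θ
      - a / (Real.sqrt (1 - (1 - a) * Real.sin θ ^ 2) + Real.cos θ)) = 0 := by
  have hcont_r : Continuous (fun θ : ℝ ↦ Real.sqrt (1 - (1 - a) * Real.sin θ ^ 2)) := by fun_prop
  have hderiv : ∀ x ∈ uIcc (0 : ℝ) (π / 2),
      HasDerivAt (fun θ : ℝ ↦ a * (Real.sin θ * Real.cos θ /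
        (Real.sqrt (1 - (1 - a) * Real.sin θ ^ 2) + Real.cos θ)))
      (a / Real.sqrt (1 - (1 - a) * Real.sin x ^ 2)
        - Real.sqrt (1 - (1 - a) * Real.sin x ^ 2) + Real.cos x
        - a / (Real.sqrt (1 - (1 - a) * Real.sin x ^ 2) + Real.cos x)) x := by
    intro x hx
    rw [uIcc_of_le (by positivity)] at hx
    have hc0 : 0 ≤ Real.cos x :=
      Real.cos_nonneg_of_mem_Icc ⟨by linarith [hx.1, Real.pi_pos], hx.2⟩
    have hr := sqrt_ellS_pos ha x
    have hS := one_le_ellS ha x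
    have hSne : 1 - (1 - a) * Real.sin x ^ 2 ≠ 0 := by linarith
    have h1 := (Real.hasDerivAt_sin x).pow 2
    simp only [Nat.cast_ofNat, Nat.add_one_sub_one, pow_one] at h1
    have hSd : HasDerivAt (fun y ↦ 1 - (1 - a) * Real.sin y ^ 2)
        (-((1 - a) * (2 * Real.sin x * Real.cos x))) x := (h1.const_mul (1 - a)).const_sub 1
    have hR : HasDerivAt (fun y ↦ Real.sqrt (1 - (1 - a) * Real.sin y ^ 2))
        (-((1 - a) * (2 * Real.sin x * Real.cos x)) /
          (2 * Real.sqrt (1 - (1 - a) * Real.sin x ^ 2))) x := hSd.sqrt hSne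
    have hN : HasDerivAt (fun y ↦ Real.sin y * Real.cos y)
        (Real.cos x * Real.cos x + Real.sin x * -Real.sin x) x :=
      (Real.hasDerivAt_sin x).fun_mul (Real.hasDerivAt_cos x)
    have hD : HasDerivAt (fun y ↦ Real.sqrt (1 - (1 - a) * Real.sin y ^ 2) + Real.cos y)
        (-((1 - a) * (2 * Real.sin x * Real.cos x)) /
          (2 * Real.sqrt (1 - (1 - a) * Real.sin x ^ 2)) + -Real.sin x) x :=
      hR.fun_add (Real.hasDerivAt_cos x)
    have hDne : Real.sqrt (1 - (1 - a) * Real.sin x ^ 2) + Real.cos x ≠ 0 := by positivity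
    have hGd := (hN.fun_div hD hDne).const_mul a
    refine hGd.congr_deriv ?_
    have hsc : Real.sin x ^ 2 + Real.cos x ^ 2 = 1 := Real.sin_sq_add_cos_sq x
    set s := Real.sin x with hs_def
    set c := Real.cos x with hc_def
    have hr2 : Real.sqrt (1 - (1 - a) * s ^ 2) ^ 2 = 1 - (1 - a) * s ^ 2 := Real.sq_sqrt (by linarith)
    set r := Real.sqrt (1 - (1 - a) * s ^ 2) with hr_def
    have hr0 : r ≠ 0 := hr.ne'
    have poly : 2 * a * r * (c ^ 2 - s ^ 2) * (r + c) + a * s * c * (1 - a) * (2 * s * c)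
        + 2 * a * r * s ^ 2 * c - 2 * a * (r + c) ^ 2 + 2 * r ^ 2 * (r + c) ^ 2
        - 2 * r * c * (r + c) ^ 2 + 2 * a * r * (r + c) = 0 := by
      linear_combination (2 * ((a - 1) * r ^ 2 + (a - 1) * r * c - a ^ 2 * s ^ 2 + a * s ^ 2 - a)) * hsc
        + (2 * (r ^ 2 + r * c - a * s ^ 2 + a)) * hr2
    have e1 : a * (((c * c + s * -s) * (r + c) - s * c * (-((1 - a) * (2 * s * c)) / (2 * r) + -s)) /
          (r + c) ^ 2) - (a / r - r + c - a / (r + c)) =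
        (2 * a * r * (c ^ 2 - s ^ 2) * (r + c) + a * s * c * (1 - a) * (2 * s * c)
          + 2 * a * r * s ^ 2 * c - 2 * a * (r + c) ^ 2 + 2 * r ^ 2 * (r + c) ^ 2
          - 2 * r * c * (r + c) ^ 2 + 2 * a * r * (r + c)) / ((r + c) ^ 2 * (2 * r)) := by
      field_simp
      ring
    rw [← sub_eq_zero, e1, poly, zero_div]
  have hint : IntervalIntegrable (fun θ : ℝ ↦ a / Real.sqrt (1 - (1 - a) * Real.sin θ ^ 2)
      - Real.sqrt (1 - (1 - a) * Real.sin θ ^ 2) + Real.cos θ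
      - a / (Real.sqrt (1 - (1 - a) * Real.sin θ ^ 2) + Real.cos θ)) volume 0 (π / 2) := by
    refine ContinuousOn.intervalIntegrable ?_
    rw [uIcc_of_le (by positivity)]
    refine ContinuousOn.sub ((ContinuousOn.sub ?_ hcont_r.continuousOn).add
      Real.continuous_cos.continuousOn) ?_
    · exact (continuous_const.div hcont_r fun θ ↦ (sqrt_ellS_pos ha θ).ne').continuousOn
    · refine ContinuousOn.div continuousOn_const
        (hcont_r.continuousOn.add Real.continuous_cos.continuousOn) fun θ hθ ↦ ?_
      have := Real.cos_nonneg_of_mem_Icc ⟨by linarith [hθ.1, Real.pi_pos], hθ.2⟩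
      have := sqrt_ellS_pos ha θ
      positivity
  rw [intervalIntegral.integral_eq_sub_of_hasDerivAt hderiv hint]
  simp

/-- RH-FREE, PROVED: discharge of the named fact `CM22_lemma_3_1` (**Lemma 3.1**,
`I(a) = aK(1−a) − E(1−a) + 1` for `a ≥ 1`), along the printed proof: a substitution (`y = 1/sin θ`,
i.e. the paper's `x = 1/t` followed by `t = sin θ`, which makes every integral proper) and the boundary
function `g` (`∫ g′ = 0`).
[cite: ConnesMoscovici2022, Lemma 3.1 eq. (3.4) (= arXiv Lemma 4.1 (4.4), chunk p0009:L48–L52; proof L54–L70)] -/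
theorem CM22_lemma_3_1_holds : CM22_lemma_3_1 := by
  intro a ha
  rw [cmAreaIntegral_eq_integral_theta ha, ← integral_Ioc_eq_integral_Ioo,
    ← intervalIntegral.integral_of_le (by positivity : (0 : ℝ) ≤ π / 2)]
  unfold ellipticK ellipticE
  have hcont_r : Continuous (fun θ : ℝ ↦ Real.sqrt (1 - (1 - a) * Real.sin θ ^ 2)) := by fun_prop
  have i1 : IntervalIntegrable (fun θ : ℝ ↦ a / Real.sqrt (1 - (1 - a) * Real.sin θ ^ 2))
      volume 0 (π / 2) :=
    (continuous_const.div hcont_r fun θ ↦ (sqrt_ellS_pos ha θ).ne').intervalIntegrable _ _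
  have i2 : IntervalIntegrable (fun θ : ℝ ↦ Real.sqrt (1 - (1 - a) * Real.sin θ ^ 2))
      volume 0 (π / 2) := hcont_r.intervalIntegrable _ _
  have i3 : IntervalIntegrable (fun θ : ℝ ↦ Real.cos θ) volume 0 (π / 2) :=
    Real.continuous_cos.intervalIntegrable _ _
  have i4 : IntervalIntegrable (fun θ : ℝ ↦
      a / (Real.sqrt (1 - (1 - a) * Real.sin θ ^ 2) + Real.cos θ)) volume 0 (π / 2) := by
    refine ContinuousOn.intervalIntegrable ?_
    rw [uIcc_of_le (by positivity)]
    refine ContinuousOn.div continuousOn_const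
      (hcont_r.continuousOn.add Real.continuous_cos.continuousOn) fun θ hθ ↦ ?_
    have := Real.cos_nonneg_of_mem_Icc ⟨by linarith [hθ.1, Real.pi_pos], hθ.2⟩
    have := sqrt_ellS_pos ha θ
    positivity
  have h0 := integral_boundary_term ha
  rw [intervalIntegral.integral_sub ((i1.sub i2).add i3) i4,
    intervalIntegral.integral_add (i1.sub i2) i3, intervalIntegral.integral_sub i1 i2,
    integral_cos, Real.sin_pi_div_two, Real.sin_zero] at h0
  have hK : ∫ θ in (0 : ℝ)..(π / 2), a / Real.sqrt (1 - (1 - a) * Real.sin θ ^ 2) =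
      a * ∫ θ in (0 : ℝ)..(π / 2), 1 / Real.sqrt (1 - (1 - a) * Real.sin θ ^ 2) := by
    rw [← intervalIntegral.integral_const_mul]
    congr 1
    funext θ
    ring
  linarith [h0, hK]

end EllipticIntegral

/-! ## §4 (= arXiv §5): Dirac operators (Darboux process on `(λ, ∞)`) -/

/-- RH-FREE object. `p(x) = x² − λ²` on `(λ, ∞)` (note the sign: `L = ∂(p∂) + V` is `W` there).
[cite: ConnesMoscovici2022, Lemma 4.1 (= arXiv Lemma 5.1, chunk p0010:L5)] -/
def pOut (lam : ℝ) (x : ℝ) : ℝ := x ^ 2 - lam ^ 2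

/-- RH-FREE object. `V(x) = 4π²λ²x²`. [cite: ConnesMoscovici2022, Lemma 4.1 (= arXiv Lemma 5.1, chunk p0010:L5)] -/
def vPot (lam : ℝ) (x : ℝ) : ℝ := 4 * π ^ 2 * lam ^ 2 * x ^ 2

/-- RH-FREE object. `L = ∂(p(x)∂) + V(x)` on functions on `(λ, ∞)`. [cite: ConnesMoscovici2022, Lemma 4.1 (= arXiv Lemma 5.1, chunk p0010:L5)] -/
def opL (lam : ℝ) (f : ℝ → ℂ) (x : ℝ) : ℂ :=
  deriv (fun y ↦ ((pOut lam y : ℝ) : ℂ) * deriv f y) x + ((vPot lam x : ℝ) : ℂ) * f x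

/-- RH-FREE object. `(∇f)(x) := p(x)^{1/2} ∂f(x)`. [cite: ConnesMoscovici2022, Lemma 4.1 (= arXiv Lemma 5.1, chunk p0010:L5)] -/
def opNabla (lam : ℝ) (f : ℝ → ℂ) (x : ℝ) : ℂ := ((Real.sqrt (pOut lam x) : ℝ) : ℂ) * deriv f x

/-- RH-FREE object. `U(ξ)(x) := p(x)^{1/4} ξ(x)` (the unitary
`L²([λ,∞), dx) → L²([λ,∞), p^{-1/2}dx)`, here at the level of functions). [cite: ConnesMoscovici2022, Lemma 4.1, display (= arXiv Lemma 5.1, chunk p0010:L7–L9)] -/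
def opU (lam : ℝ) (f : ℝ → ℂ) (x : ℝ) : ℂ := (((pOut lam x) ^ (1 / 4 : ℝ) : ℝ) : ℂ) * f x

/-- RH-FREE object. `U* = U⁻¹`: multiplication by `p^{-1/4}`. [cite: ConnesMoscovici2022, Lemma 4.1 (= arXiv Lemma 5.1, chunk p0010:L7–L12)] -/
def opUinv (lam : ℝ) (f : ℝ → ℂ) (x : ℝ) : ℂ := (((pOut lam x) ^ (-(1 / 4 : ℝ)) : ℝ) : ℂ) * f x

/-- RH-FREE object. **The Riccati equation (4.1)**:
`∇w + w² = −V + (p″/4 − p′²/(16p))` on `(λ, ∞)` (`p″ = 2`, `p′ = 2x`).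
[cite: ConnesMoscovici2022, Lemma 4.1 eq. (4.1) (= arXiv (5.1), chunk p0010:L10–L12) and (4.2) (= arXiv (5.2), L28)] -/
def IsRiccatiSol (lam : ℝ) (w : ℝ → ℂ) : Prop :=
  DifferentiableOn ℝ w (Ioi lam) ∧
  ∀ x ∈ Ioi lam, opNabla lam w x + w x ^ 2 =
    -((vPot lam x : ℝ) : ℂ) + (((2 : ℝ) / 4 - (2 * x) ^ 2 / (16 * pOut lam x) : ℝ) : ℂ)

/-- NAMED FACT (RH-FREE; an identity of differential expressions) — DISCHARGED below
(`CM22_lemma_4_1_holds`).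
**Lemma 4.1** (= arXiv Lemma 5.1, Darboux factorisation): for `w` a solution of (4.1) "one has
`L = U*(∇ + w)(∇ − w)U`" — typed pointwise on `C²` functions on `(λ, ∞)`.
[cite: ConnesMoscovici2022, Lemma 4.1 (= arXiv Lemma 5.1, chunk p0010:L5–L13; proof L15–L26)] -/
def CM22_lemma_4_1 : Prop :=
  ∀ lam : ℝ, 0 < lam → ∀ w : ℝ → ℂ, IsRiccatiSol lam w →
    ∀ f : ℝ → ℂ, ContDiffOn ℝ 2 f (Ioi lam) → ∀ x ∈ Ioi lam,
      opL lam f x =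
        opUinv lam (fun y ↦ opNabla lam (fun z ↦ opNabla lam (opU lam f) z - w z * opU lam f z) y +
          w y * (opNabla lam (opU lam f) y - w y * opU lam f y)) x

/-- NAMED FACT (RH-FREE). **Lemma 4.2** (= arXiv Lemma 5.2): for two real solutions `u₁, u₂` of
`Lu = 0` generating the solution space on `(λ, ∞)`: "(i) For `z ∈ ℂ` and `u = u₁ + zu₂` the solution
`u` has no zero in `(λ,∞)` if `z ∉ ℝ` and an infinity of zeros otherwise. (ii) All solutions of the
Riccati equation (4.2) are given by `w_z = p^{1/4}∂(p^{1/4}u)/u`, `u = u₁ + zu₂`, `z ∈ ℂ ∖ ℝ`.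
(iii) The map `z ↦ w_z` … is a homeomorphism" — typed: (i); each `w_z`, `z ∉ ℝ`, solves (4.2);
every solution is `w_z` for a unique `z ∉ ℝ` ((iii) as a bijection; continuity not typed).
[cite: ConnesMoscovici2022, Lemma 4.2 (= arXiv Lemma 5.2, chunk p0010:L41–L47; proof L49–L86)] -/
def CM22_lemma_4_2 : Prop :=
  ∀ lam : ℝ, 0 < lam → ∀ u₁ u₂ : ℝ → ℝ,
    ContDiffOn ℝ 2 u₁ (Ioi lam) → ContDiffOn ℝ 2 u₂ (Ioi lam) →
    (∀ x ∈ Ioi lam, opL lam (fun y ↦ (u₁ y : ℂ)) x = 0) →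
    (∀ x ∈ Ioi lam, opL lam (fun y ↦ (u₂ y : ℂ)) x = 0) →
    (∃ x ∈ Ioi lam, u₁ x * deriv u₂ x - u₂ x * deriv u₁ x ≠ 0) →
    (∀ z : ℂ, z.im ≠ 0 → ∀ x ∈ Ioi lam, (u₁ x : ℂ) + z * u₂ x ≠ 0) ∧
    (∀ z : ℝ, Set.Infinite {x | x ∈ Ioi lam ∧ u₁ x + z * u₂ x = 0}) ∧
    (∀ z : ℂ, z.im ≠ 0 →
      IsRiccatiSol lam fun x ↦
        (((pOut lam x) ^ (1 / 4 : ℝ) : ℝ) : ℂ) *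
          deriv (fun y ↦ (((pOut lam y) ^ (1 / 4 : ℝ) : ℝ) : ℂ) * ((u₁ y : ℂ) + z * u₂ y)) x /
          ((u₁ x : ℂ) + z * u₂ x)) ∧
    (∀ w : ℝ → ℂ, IsRiccatiSol lam w → ∃! z : ℂ, z.im ≠ 0 ∧ ∀ x ∈ Ioi lam,
      w x = (((pOut lam x) ^ (1 / 4 : ℝ) : ℝ) : ℂ) *
          deriv (fun y ↦ (((pOut lam y) ^ (1 / 4 : ℝ) : ℝ) : ℂ) * ((u₁ y : ℂ) + z * u₂ y)) x /
          ((u₁ x : ℂ) + z * u₂ x))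

/-- RH-FREE object. **The Dirac operator** `𝐃̸ = [[0, ∇ + w], [∇ − w, 0]]` acting on pairs of
functions on `(λ, ∞)`. [cite: ConnesMoscovici2022, Prop 4.3 eq. (4.6) (= arXiv Prop 5.3 (5.6), chunk p0010:L88–L97)] -/
def opDirac (lam : ℝ) (w : ℝ → ℂ) (F : (ℝ → ℂ) × (ℝ → ℂ)) : (ℝ → ℂ) × (ℝ → ℂ) :=
  (fun x ↦ opNabla lam F.2 x + w x * F.2 x, fun x ↦ opNabla lam F.1 x - w x * F.1 x)

/-- NAMED FACT (RH-FREE; identity of differential expressions) — DISCHARGED below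
(`CM22_prop_4_3_holds`). **Proposition 4.3** (= arXiv
Prop 5.3): for `w` a solution of the Riccati equation, "the square of `𝐃̸` is diagonal with each
diagonal term spectrally equivalent to `L`, `U* 𝐃̸² U = diag(L, L + 2∇w)`" ("The proof is
straightforward") — typed pointwise on pairs of `C²` functions on `(λ, ∞)`.
[cite: ConnesMoscovici2022, Prop 4.3 (= arXiv Prop 5.3, chunk p0010:L88–L106)] -/
def CM22_prop_4_3 : Prop :=
  ∀ lam : ℝ, 0 < lam → ∀ w : ℝ → ℂ, IsRiccatiSol lam w → ContDiffOn ℝ 1 w (Ioi lam) →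
    ∀ f g : ℝ → ℂ, ContDiffOn ℝ 2 f (Ioi lam) → ContDiffOn ℝ 2 g (Ioi lam) → ∀ x ∈ Ioi lam,
      let D2 := opDirac lam w (opDirac lam w (opU lam f, opU lam g))
      opUinv lam D2.1 x = opL lam f x ∧
        opUinv lam D2.2 x = opL lam g x + 2 * opNabla lam w x * g x

/-! ### Discharge of Lemma 4.1 and Proposition 4.3 (the Darboux computation, RH-FREE)

The printed proof (arXiv chunk p0010:L15–L26): for `T₁ = f∂f`, `T₂ = ∂f⁴∂` one has
`T₁² − T₂ = 2f′²f² + f³f″`, whence `(U*∇U)² = ∂p∂ + p″/4 − p′²/(16p)` for `f = p^{1/4}`, and the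
conclusion follows from the Riccati equation.  Below this is carried out pointwise at `x > λ`
(`p(x) > 0`): with `g = p^{1/4}f`, `q = √p`, the two relations `q·q′ = x`, `q² = p` and the Riccati
equation reduce `p^{-1/4}(∇ ± w)(∇ ∓ w)g` to a rational expression in `p`, `p^{1/4}` which
`field_simp; ring` identifies with `L f` (resp. `L f + 2(∇w)f`).  Helper names are private. -/

section Darboux

variable {lam : ℝ}

/-- `p(x) = x² − λ² > 0` for `x > λ > 0`. [folklore] -/
private theorem pOut_pos (hlam : 0 < lam) {x : ℝ} (hx : x ∈ Ioi lam) : 0 < pOut lam x := by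
  have : lam < x := hx
  have hx0 : 0 < x := hlam.trans this
  unfold pOut; nlinarith

/-- `p′(x) = 2x`. [folklore] -/
private theorem hasDerivAt_pOut (lam x : ℝ) : HasDerivAt (pOut lam) (2 * x) x := by
  unfold pOut
  simpa using ((hasDerivAt_pow 2 x).sub_const (lam ^ 2))

/-- Plumbing: `r = p^{1/4}` (the multiplier of `U`). [folklore] -/
private def rFn (lam : ℝ) (y : ℝ) : ℝ := (pOut lam y) ^ (1 / 4 : ℝ)
/-- Plumbing: `r′ = ¼ p^{1/4 − 1} p′`. [folklore] -/
private def r1Fn (lam : ℝ) (y : ℝ) : ℝ := (1 / 4 : ℝ) * (pOut lam y) ^ ((1 / 4 : ℝ) - 1) * (2 * y)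

/-- `(p^{1/4})′ = r′` on `(λ, ∞)` (chain rule for `rpow`). [folklore] -/
private theorem hasDerivAt_rFn (hlam : 0 < lam) {y : ℝ} (hy : y ∈ Ioi lam) :
    HasDerivAt (rFn lam) (r1Fn lam y) y := by
  have hp := (pOut_pos hlam hy).ne'
  have h := (hasDerivAt_pOut lam y).rpow_const (p := (1 / 4 : ℝ)) (Or.inl hp)
  unfold rFn r1Fn
  convert h using 1
  ring

/-- Plumbing: `r″ = ¼((1/4 − 1) p^{1/4 − 2} p′ · p′ + p^{1/4 − 1} p″)`. [folklore] -/
private def r2Fn (lam : ℝ) (y : ℝ) : ℝ :=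
  (1 / 4 : ℝ) * ((((1 / 4 : ℝ) - 1) * (pOut lam y) ^ ((1 / 4 : ℝ) - 1 - 1) * (2 * y)) * (2 * y) +
    (pOut lam y) ^ ((1 / 4 : ℝ) - 1) * 2)

/-- `(r′)′ = r″` on `(λ, ∞)` (product and chain rule). [folklore] -/
private theorem hasDerivAt_r1Fn (hlam : 0 < lam) {y : ℝ} (hy : y ∈ Ioi lam) :
    HasDerivAt (r1Fn lam) (r2Fn lam y) y := by
  have hp := (pOut_pos hlam hy).ne'
  have h1 := (hasDerivAt_pOut lam y).rpow_const (p := (1 / 4 : ℝ) - 1) (Or.inl hp)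
  have h2 : HasDerivAt (fun y : ℝ ↦ 2 * y) 2 y := by
    simpa using (hasDerivAt_id y).const_mul 2
  have h := (h1.mul h2).const_mul (1 / 4 : ℝ)
  simp only [Pi.mul_apply] at h
  have hfun : r1Fn lam = fun z ↦ (1 / 4 : ℝ) * ((pOut lam z) ^ ((1 / 4 : ℝ) - 1) * (2 * z)) := by
    funext z; unfold r1Fn; ring
  rw [hfun]
  refine h.congr_deriv ?_
  unfold r2Fn
  ring

/-- `(√p)′ = p′/(2√p)` on `(λ, ∞)`. [folklore] -/
private theorem hasDerivAt_sqrt_pOut (hlam : 0 < lam) {y : ℝ} (hy : y ∈ Ioi lam) :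
    HasDerivAt (fun y ↦ Real.sqrt (pOut lam y)) (2 * y / (2 * Real.sqrt (pOut lam y))) y :=
  (hasDerivAt_pOut lam y).sqrt (pOut_pos hlam hy).ne'


/-- The pointwise Darboux computation of the printed proofs of Lemma 4.1 / Prop 4.3: with
`g = p^{1/4} f`, `p^{-1/4}·(∇ ± w)(∇ ∓ w) g = L f` resp. `L f + 2(∇w) f`, using `q·q' = x`, `q² = p`
(`q = √p`) and the Riccati equation.
[cite: ConnesMoscovici2022, Lemma 4.1 proof and Prop 4.3 (= arXiv Lemma 5.1, chunk p0010:L15–L26; Prop 5.3, L88–L106)] -/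
private theorem darboux_pointwise (hlam : 0 < lam) {w : ℝ → ℂ} (hw : IsRiccatiSol lam w) {f : ℝ → ℂ}
    (hf : ContDiffOn ℝ 2 f (Ioi lam)) {x : ℝ} (hx : x ∈ Ioi lam) :
    opUinv lam (fun y ↦ opNabla lam (fun z ↦ opNabla lam (opU lam f) z - w z * opU lam f z) y +
        w y * (opNabla lam (opU lam f) y - w y * opU lam f y)) x = opL lam f x ∧
    opUinv lam (fun y ↦ opNabla lam (fun z ↦ opNabla lam (opU lam f) z + w z * opU lam f z) y -
        w y * (opNabla lam (opU lam f) y + w y * opU lam f y)) x =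
      opL lam f x + 2 * opNabla lam w x * f x := by
  obtain ⟨hwd, hRic⟩ := hw
  have hxo : Ioi lam ∈ 𝓝 x := isOpen_Ioi.mem_nhds hx
  have hp0 : 0 < pOut lam x := pOut_pos hlam hx
  -- derivatives of `f` and `w`
  have hf1 : ∀ y ∈ Ioi lam, HasDerivAt f (deriv f y) y := fun y hy ↦
    ((hf.differentiableOn (by norm_num)).differentiableAt (isOpen_Ioi.mem_nhds hy)).hasDerivAt
  have hdf : DifferentiableOn ℝ (deriv f) (Ioi lam) :=
    (hf.deriv_of_isOpen (m := 1) isOpen_Ioi (by norm_num)).differentiableOn (by norm_num)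
  have hf2 : HasDerivAt (deriv f) (deriv (deriv f) x) x :=
    (hdf.differentiableAt hxo).hasDerivAt
  have hw1 : HasDerivAt w (deriv w x) x := (hwd.differentiableAt hxo).hasDerivAt
  -- `g = U f = p^{1/4} f`, its derivative `G1` on `(λ, ∞)` and its second derivative `g2` at `x`
  set g : ℝ → ℂ := fun t ↦ ((rFn lam t : ℝ) : ℂ) * f t with hg
  have hUg : opU lam f = g := by
    funext t; simp only [opU, hg, rFn]
  set G1 : ℝ → ℂ := fun t ↦ ((r1Fn lam t : ℝ) : ℂ) * f t + ((rFn lam t : ℝ) : ℂ) * deriv f t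
    with hG1
  have hg1 : ∀ y ∈ Ioi lam, HasDerivAt g (G1 y) y := fun y hy ↦
    ((hasDerivAt_rFn hlam hy).ofReal_comp).fun_mul (hf1 y hy)
  have hdg : deriv g =ᶠ[𝓝 x] G1 :=
    Filter.eventually_of_mem hxo fun y hy ↦ (hg1 y hy).deriv
  have hdgx : deriv g x = G1 x := (hg1 x hx).deriv
  set g2 : ℂ := ((r2Fn lam x : ℝ) : ℂ) * f x + ((r1Fn lam x : ℝ) : ℂ) * deriv f x +
    (((r1Fn lam x : ℝ) : ℂ) * deriv f x + ((rFn lam x : ℝ) : ℂ) * deriv (deriv f) x) with hg2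
  have hG1d : HasDerivAt G1 g2 x :=
    (((hasDerivAt_r1Fn hlam hx).ofReal_comp).fun_mul (hf1 x hx)).fun_add
      (((hasDerivAt_rFn hlam hx).ofReal_comp).fun_mul hf2)
  have hdg2 : HasDerivAt (deriv g) g2 x := hG1d.congr_of_eventuallyEq hdg
  -- `(∇ ∓ w) U f` and their derivatives at `x`
  have hHm : HasDerivAt (fun y ↦ ((Real.sqrt (pOut lam y) : ℝ) : ℂ) * deriv g y - w y * g y)
      ((((2 * x / (2 * Real.sqrt (pOut lam x)) : ℝ) : ℂ) * deriv g x +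
        ((Real.sqrt (pOut lam x) : ℝ) : ℂ) * g2) - (deriv w x * g x + w x * G1 x)) x :=
    (((hasDerivAt_sqrt_pOut hlam hx).ofReal_comp).fun_mul hdg2).fun_sub (hw1.fun_mul (hg1 x hx))
  have hHp : HasDerivAt (fun y ↦ ((Real.sqrt (pOut lam y) : ℝ) : ℂ) * deriv g y + w y * g y)
      ((((2 * x / (2 * Real.sqrt (pOut lam x)) : ℝ) : ℂ) * deriv g x +
        ((Real.sqrt (pOut lam x) : ℝ) : ℂ) * g2) + (deriv w x * g x + w x * G1 x)) x :=
    (((hasDerivAt_sqrt_pOut hlam hx).ofReal_comp).fun_mul hdg2).fun_add (hw1.fun_mul (hg1 x hx))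
  have hLHS : deriv (fun y ↦ ((pOut lam y : ℝ) : ℂ) * deriv f y) x =
      (((2 * x : ℝ)) : ℂ) * deriv f x + ((pOut lam x : ℝ) : ℂ) * deriv (deriv f) x :=
    (((hasDerivAt_pOut lam x).ofReal_comp).fun_mul hf2).deriv
  -- rewrite both sides of both goals
  simp only [opL, opUinv, opNabla, hUg]
  rw [hLHS, hHm.deriv, hHp.deriv, hdgx]
  -- scalar relations at `x`
  have hp0c : ((pOut lam x : ℝ) : ℂ) ≠ 0 := by exact_mod_cast hp0.ne'
  have hs0c : ((Real.sqrt (pOut lam x) : ℝ) : ℂ) ≠ 0 := by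
    exact_mod_cast (Real.sqrt_pos.2 hp0).ne'
  have hr0c : (((pOut lam x) ^ (1 / 4 : ℝ) : ℝ) : ℂ) ≠ 0 := by
    exact_mod_cast (Real.rpow_pos_of_pos hp0 _).ne'
  have hqq : ((Real.sqrt (pOut lam x) : ℝ) : ℂ) ^ 2 = ((pOut lam x : ℝ) : ℂ) := by
    exact_mod_cast Real.sq_sqrt hp0.le
  have hqs : ((Real.sqrt (pOut lam x) : ℝ) : ℂ) *
      (((2 * x / (2 * Real.sqrt (pOut lam x))) : ℝ) : ℂ) = (x : ℂ) := by
    push_cast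
    field_simp
  have hr1 : (pOut lam x) ^ ((1 / 4 : ℝ) - 1) = (pOut lam x) ^ (1 / 4 : ℝ) / pOut lam x :=
    Real.rpow_sub_one hp0.ne' _
  have hr2 : (pOut lam x) ^ ((1 / 4 : ℝ) - 1 - 1) =
      (pOut lam x) ^ (1 / 4 : ℝ) / pOut lam x / pOut lam x := by
    rw [Real.rpow_sub_one hp0.ne', hr1]
  have hrinv : (pOut lam x) ^ (-(1 / 4 : ℝ)) = ((pOut lam x) ^ (1 / 4 : ℝ))⁻¹ :=
    Real.rpow_neg hp0.le _
  have hRx : ((Real.sqrt (pOut lam x) : ℝ) : ℂ) * deriv w x + w x ^ 2 =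
      -((vPot lam x : ℝ) : ℂ) + (((2 : ℝ) / 4 - (2 * x) ^ 2 / (16 * pOut lam x) : ℝ) : ℂ) :=
    hRic x hx
  have hcg : (((pOut lam x) ^ (-(1 / 4 : ℝ)) : ℝ) : ℂ) * g x = f x := by
    simp only [hg, rFn]
    rw [hrinv]
    push_cast
    field_simp
  -- step 1 (`q q' = x`, `q² = p`, Riccati): `p^{-1/4}(∇ ± w)(∇ ∓ w) g = p^{-1/4}(x G₁ + p g₂ + (V−K) g) [+ 2 q w' f]`
  have keym :
      (((pOut lam x) ^ (-(1 / 4 : ℝ)) : ℝ) : ℂ) *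
          (((Real.sqrt (pOut lam x) : ℝ) : ℂ) *
              (((((2 * x / (2 * Real.sqrt (pOut lam x))) : ℝ) : ℂ) * G1 x +
                  ((Real.sqrt (pOut lam x) : ℝ) : ℂ) * g2) -
                (deriv w x * g x + w x * G1 x)) +
            w x * (((Real.sqrt (pOut lam x) : ℝ) : ℂ) * G1 x - w x * g x)) =
        (((pOut lam x) ^ (-(1 / 4 : ℝ)) : ℝ) : ℂ) *
          ((x : ℂ) * G1 x + ((pOut lam x : ℝ) : ℂ) * g2 +
            (((vPot lam x : ℝ) : ℂ) -
              (((2 : ℝ) / 4 - (2 * x) ^ 2 / (16 * pOut lam x) : ℝ) : ℂ)) * g x) := by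
    linear_combination (((pOut lam x) ^ (-(1 / 4 : ℝ)) : ℝ) : ℂ) * G1 x * hqs
      + (((pOut lam x) ^ (-(1 / 4 : ℝ)) : ℝ) : ℂ) * g2 * hqq
      - (((pOut lam x) ^ (-(1 / 4 : ℝ)) : ℝ) : ℂ) * g x * hRx
  have keyp :
      (((pOut lam x) ^ (-(1 / 4 : ℝ)) : ℝ) : ℂ) *
          (((Real.sqrt (pOut lam x) : ℝ) : ℂ) *
              (((((2 * x / (2 * Real.sqrt (pOut lam x))) : ℝ) : ℂ) * G1 x +
                  ((Real.sqrt (pOut lam x) : ℝ) : ℂ) * g2) +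
                (deriv w x * g x + w x * G1 x)) -
            w x * (((Real.sqrt (pOut lam x) : ℝ) : ℂ) * G1 x + w x * g x)) =
        (((pOut lam x) ^ (-(1 / 4 : ℝ)) : ℝ) : ℂ) *
          ((x : ℂ) * G1 x + ((pOut lam x : ℝ) : ℂ) * g2 +
            (((vPot lam x : ℝ) : ℂ) -
              (((2 : ℝ) / 4 - (2 * x) ^ 2 / (16 * pOut lam x) : ℝ) : ℂ)) * g x) +
          2 * (((Real.sqrt (pOut lam x) : ℝ) : ℂ) * deriv w x) * f x := by
    linear_combination (((pOut lam x) ^ (-(1 / 4 : ℝ)) : ℝ) : ℂ) * G1 x * hqs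
      + (((pOut lam x) ^ (-(1 / 4 : ℝ)) : ℝ) : ℂ) * g2 * hqq
      - (((pOut lam x) ^ (-(1 / 4 : ℝ)) : ℝ) : ℂ) * g x * hRx
      + 2 * (((Real.sqrt (pOut lam x) : ℝ) : ℂ) * deriv w x) * hcg
  -- step 2: the rational identity in `p`, `p^{1/4}`: `p^{-1/4}(x G₁ + p g₂ + (V−K) g) = L f`
  have final :
      (((2 * x : ℝ)) : ℂ) * deriv f x + ((pOut lam x : ℝ) : ℂ) * deriv (deriv f) x +
          ((vPot lam x : ℝ) : ℂ) * f x =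
        (((pOut lam x) ^ (-(1 / 4 : ℝ)) : ℝ) : ℂ) *
          ((x : ℂ) * G1 x + ((pOut lam x : ℝ) : ℂ) * g2 +
            (((vPot lam x : ℝ) : ℂ) -
              (((2 : ℝ) / 4 - (2 * x) ^ 2 / (16 * pOut lam x) : ℝ) : ℂ)) * g x) := by
    simp only [hG1, hg2, hg, rFn, r1Fn, r2Fn]
    rw [hr1, hr2, hrinv]
    push_cast
    field_simp
    ring
  constructor
  · linear_combination keym - final
  · linear_combination keyp - final

/-- RH-FREE, PROVED: discharge of the named fact `CM22_lemma_4_1` (**Lemma 4.1**, Darboux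
factorisation `L = U*(∇ + w)(∇ − w)U`, pointwise on `C²` functions on `(λ, ∞)`), by the printed
computation: `(U*∇U)² = ∂p∂ + p″/4 − p′²/(16p)` and the Riccati equation (4.1).
[cite: ConnesMoscovici2022, Lemma 4.1 (= arXiv Lemma 5.1, chunk p0010:L5–L13; proof L15–L26)] -/
theorem CM22_lemma_4_1_holds : CM22_lemma_4_1 :=
  fun _lam hlam _w hw _f hf _x hx ↦ (darboux_pointwise hlam hw hf hx).1.symm

/-- RH-FREE, PROVED: discharge of the named fact `CM22_prop_4_3` (**Proposition 4.3**,
`U*𝐃̸²U = diag(L, L + 2∇w)` pointwise on pairs of `C²` functions on `(λ, ∞)`; "The proof is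
straightforward": `(∇ − w)(∇ + w) = (∇ + w)(∇ − w) + 2(∇w)`).
[cite: ConnesMoscovici2022, Prop 4.3 (= arXiv Prop 5.3, chunk p0010:L88–L106)] -/
theorem CM22_prop_4_3_holds : CM22_prop_4_3 := by
  intro lam hlam w hw _ f g hf hg x hx
  dsimp only [opDirac]
  exact ⟨(darboux_pointwise hlam hw hf hx).1, (darboux_pointwise hlam hw hg hx).2⟩

end Darboux

/-! ## §5 (= arXiv §6): UV behaviour of the spectrum, `λ = √2` -/

/-- RH-FREE object. The even-sector count `N⁺_W(E) = Σ_{−E² ≤ μ < 0} dim(Ker(W − μ) ∩ L²_ev)` of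
negative eigenvalues of `W` on even functions (the quantity the printed proof of Thm 5.1 counts; a
`finrank`, junk `0` if the span were infinite-dimensional — excluded by `CM22_thm_5_1`).
[cite: ConnesMoscovici2022, Thm 5.1, proof (= arXiv Thm 6.1, chunk p0011:L12–L20); Prop 3.2 (= arXiv Prop 4.2, chunk p0009:L74)] -/
def negEigenCountEven (W : L2R →ₗ.[ℂ] L2R) (E : ℝ) : ℕ :=
  Module.finrank ℂ
    (⨆ μ : {μ : ℝ // -E ^ 2 ≤ μ ∧ μ < 0},
      W.eigenspace ((μ : ℝ) : ℂ) ⊓ ConnesConsani2021.evenPart : Submodule ℂ L2R)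

/-- NAMED FACT (RH-FREE; TYPED IN REDUCED FORM). **Theorem 5.1** (= arXiv Theorem 6.1), `λ = √2`:
"The operator `2𝐃̸` has discrete simple spectrum contained in `ℝ ∪ iℝ`. Its imaginary eigenvalues are
symmetric under complex conjugation and the counting function `N(E)` counting those of positive
imaginary part less than `E` fulfills `N(E) ∼ (E/2π)(log(E/2π) − 1) + O(1)`."  The Hilbert-space
domain of `𝐃̸` is not specified in print; the printed proof reduces everything through Prop 4.3 to the
spectrum of `L` (`= W_sa` off `[−λ, λ]`): "the spectrum of `2𝐃̸` consists of the complex numbers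
`ξ = ±2√α` where `α` varies in the spectrum of `L` … `0 < Im ξ ≤ E ⟺ α ≥ −(E/2)²` … and the number
`N(E)` of such `ξ` is thus `2σ(E/2, √2) = (E/2π)(log(E/2π) − 1) + O(1)`" (one parity sector,
Prop 3.2).  TYPED, accordingly, as: for `W = W_sa` at `λ = √2`, every negative even-sector eigenvalue
is simple, the even-sector negative eigenspaces in `[−(E/2)², 0)` span a finite-dimensional space,
and `N(E) := N⁺_W(E/2)` satisfies `N(E) = (E/2π)(log(E/2π) − 1) + O(1)` — reality/imaginarity and
conjugation symmetry of `±2√α`, `α ∈ ℝ`, being then automatic.  NOTE (label): the printed proof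
equates the true count with the SEMICLASSICAL one of Prop 3.2; the fact is recorded as printed
(refereed, PNAS), not endorsed.
[cite: ConnesMoscovici2022, Thm 5.1 eq. (5.1) (= arXiv Thm 6.1 (6.1), chunk p0011:L6–L10; proof L12–L22)] -/
def CM22_thm_5_1 : Prop :=
  ∀ W : L2R →ₗ.[ℂ] L2R, IsProlateSA (Real.sqrt 2) W →
    (∀ μ : ℝ, μ < 0 →
      Module.finrank ℂ (W.eigenspace (μ : ℂ) ⊓ ConnesConsani2021.evenPart : Submodule ℂ L2R) ≤ 1) ∧
    (∀ E : ℝ, FiniteDimensional ℂ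
      (⨆ μ : {μ : ℝ // -(E / 2) ^ 2 ≤ μ ∧ μ < 0},
        W.eigenspace ((μ : ℝ) : ℂ) ⊓ ConnesConsani2021.evenPart : Submodule ℂ L2R)) ∧
    (fun E : ℝ ↦ (negEigenCountEven W (E / 2) : ℝ) -
        E / (2 * π) * (Real.log (E / (2 * π)) - 1)) =O[atTop] fun _ ↦ (1 : ℝ)

/-- RH-FREE, PROVED. The closing arithmetic of the printed proof of Thm 5.1:
`2σ(E/2, √2)`'s main term is `(E/2π)(log((E/2)/2π) − 1 + log 4 − 2 log √2) + 2·(√2)²`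
`= (E/2π)(log(E/2π) − 1) + 4` ("`= (E/2π)(log(E/2π) − 1) + O(1)`").
[cite: ConnesMoscovici2022, Thm 5.1, last two displays of the proof (= arXiv Thm 6.1, chunk p0011:L18–L22)] -/
theorem two_mul_cmSigmaMain_half_sqrt_two {E : ℝ} (hE : 0 < E) :
    2 * cmSigmaMain (E / 2) (Real.sqrt 2) = E / (2 * π) * (Real.log (E / (2 * π)) - 1) + 4 := by
  unfold cmSigmaMain
  have h2 : Real.log (Real.sqrt 2) = Real.log 2 / 2 := by
    rw [Real.sqrt_eq_rpow, Real.log_rpow (by norm_num : (0:ℝ) < 2)]; ring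
  have h4 : Real.log 4 = 2 * Real.log 2 := by
    rw [show (4:ℝ) = 2 ^ 2 by norm_num, Real.log_pow]; norm_num
  have hsq : Real.sqrt 2 ^ 2 = 2 := Real.sq_sqrt (by norm_num)
  have hE2 : Real.log (E / 2 / (2 * π)) = Real.log (E / (2 * π)) - Real.log 2 := by
    rw [show E / 2 / (2 * π) = E / (2 * π) / 2 by ring, Real.log_div (by positivity) (by norm_num)]
  rw [h2, h4, hsq, hE2]
  ring

end Literature.NumberTheory.ConnesMoscovici2022

end
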